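import Literature.MathematicalPhysics.QuantumFieldTheory.Balaban1983to89.T4TermReprCoupling
import Literature.MathematicalPhysics.QuantumFieldTheory.Balaban1983to89.T4FiniteEpsInhabited
import Literature.MathematicalPhysics.QuantumFieldTheory.Balaban1983to89.BlockAveragingEMLFibreLawSUN

/-!
# T⁴ programme, node U5b/U5.E — ONE AVERAGING STEP AS A DISINTEGRATION: the renormalization transformation as a KERNEL

Literature unit `Balaban1983to89`, cell `pub-balaban`, estimate row T4-U5b.E2 (η-instantiation, record `t4/T4-EST-U5bE2.md`
§13–§18), version tag v1.3 (2026-08-19, lineage pv07; v1 = p188751, v1.1 = p189024 APPENDED §5, v1.2 = p189202 APPENDED §6; §§1–6 unchanged byte for byte; v1.3 APPENDS §7).  HONEST FRAMING: this module is KERNEL BOOKKEEPING for the cell's η-design;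
it proves NO estimate of [Balaban1988RG2] / [Balaban1989LargeFieldII] and asserts nothing printed.  Every declaration is
[folklore] measure theory (Mathlib: `Measure.map`, `Measure.condKernel`, `Measure.disintegrate`, `Measure.rnDeriv`,
`Measure.withDensity_rnDeriv_eq`, `IsClosed.polishSpace`, `StandardBorelSpace.pi_countable`) applied to the cell's own typed objects `Setup.fieldMeasure`, `Setup.IsRT`, `Setup.RTOpI`,
`T4FiniteEpsInhabited.HaarAC`, `T4TermReprCoupling.rnNN` / `withDensity_compProd_condKernel`, `T4LipschitzLedger.TermRepr`.
The δ-function formula `(Tρ)(V) = ∫ dU δ(ŪV⁻¹) ρ(U)` of Bałaban's renormalization transformation enters ONLY through the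
cell's certified push-forward reading `Setup.IsRT` (whose docstring carries the locators B7 (10) p. 19 / B12 (0.13) p. 254);
it is not re-quoted here.

## What this module supplies (owed item (o2′) of record `t4/T4-EST-U5bE2.md` §14, FIRST NON-TOY RUNG)

The η-instantiation recipe (record §13, tree `T4TermReprCoupling` §6 `termRepr_cpl_of_disintegration`) asks, per matched
term, for run B's reference measure IN PRODUCT FORM `Ω_A × Ω_F` (common coordinates × finest fibre), FINITE, with a standard
Borel non-empty fibre and an absolutely continuous common-coordinate marginal.  For ONE averaging step
`avg : GaugeField P j G → GaugeField P (j+1) G` (coarse field `V = Ū` = the common coordinates, fine field `U` = the finest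
fibre variable) all four demands are met by elementary means, and the resulting conditional kernel IS the renormalization
transformation:

* §1 (GENERIC, over abstract measurable spaces `α` ← coarse, `β` ← fine, `ν` ← `dU`, `μ` ← `dV`, `avg : β → α`):
  the JOINT LAW `jointLaw ν avg := ν.map (U ↦ (avg U, U))` on `α × β` (finite when `ν` is; first marginal `ν.map avg`,
  second marginal `ν`; carried by the graph `{z | z.1 = avg z.2}`); its CONDITIONAL KERNEL `condLaw ν avg :=
  (jointLaw ν avg).condKernel` (Markov; «the law of `U` given `Ū = V`»), which for `(ν.map avg)`-a.e. `V` gives full mass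
  to the fibre `{U | avg U = V}` (`condLaw_fibre_ae` — the kernel form of `δ(ŪV⁻¹)`); the MARGINAL DENSITY `margDensity ν μ avg
  := rnNN (jointLaw ν avg).fst μ : α → ℝ≥0`; under `ν.map avg ≪ μ` THE DISINTEGRATION
  `(μ.withDensity margDensity) ⊗ₘ condLaw = jointLaw` (`disintegration`, = `T4TermReprCoupling.withDensity_compProd_condKernel`
  by name) and its integrated form `∫ g(avg U, U) dν(U) = ∫ h(V) (∫ g(V, U) condLaw(V, dU)) dμ(V)` (`integral_graph_eq`);
  the KERNEL TRANSPORT `kernelTransport ν μ avg ρ V := h(V) · ∫ ρ d(condLaw V)` with the push-forward identity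
  `∫ (kernelTransport ρ)(V) f(V) dμ = ∫ ρ(U) f(avg U) dν` for integrable `ρ` and bounded measurable `f`
  (`integral_kernelTransport_mul`), positivity, integrability, and a.e. UNIQUENESS of densities satisfying that identity
  (`ae_eq_of_forall_integral_mul_eq`).
* §2 (GAUGE FIELDS): `GaugeField P j G` is standard Borel when `G` is (`standardBorelSpace_gaugeField`, Mathlib's countable
  product instance); with `ν := fieldMeasure P j G`, `μ := fieldMeasure P (j+1) G` and `T4FiniteEpsInhabited.HaarAC avg`
  (literally `ν.map avg ≪ μ`): `isRT_kernelTransport` — the kernel transport IS a renormalization transform in the cell's sense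
  `Setup.IsRT avg ρ (kernelTransport … ρ)` for every integrable `ρ`; hence an inhabitant `rtOpIOfKernel : RTOpI P j G av` (sibling
  of `T4FiniteEpsInhabited.rtOpIOfAC`, which transports each `ρ` separately by a Radon–Nikodym derivative — here ONE kernel
  serves every `ρ`), and `kernelTransport_ae_eq_rnTransport`: the two transforms agree `dV`-a.e.
* §2b (`SU(N)`): `SU(N)` is standard Borel (`standardBorelSpace_specialUnitaryGroup`: closed subset of the Polish matrix space,
  compactness from the tree's `Matrix.specialUnitaryGroup.instCompactSpace`); hence Bałaban's block averaging (0.4) with the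
  exp-mean-log small-loop average on `SU(N)` — measurable (`BlockAveraging.measurable_avgFun`) and `HaarAC`
  (`BlockAveragingEMLFibreLawSUN.haarAC_avgFun_expMeanLogSU_SUN`) in the standing range — carries `rtOpI_blockAvg_expMeanLogSU`:
  ONE Markov kernel transporting every integrable density (`avgKernel_expMeanLogSU_fibre_ae`: it lives on the fibres `Ū = V`).
* §3 (THE η-DICTIONARY AT ONE STEP): for families of one-step averagings indexed by the terms `(K, τ)`, a run-B
  `T4LipschitzLedger.TermRepr` against the joint laws is a `TermRepr` against `cpl dV (fibOf jointLaw)` with remainder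
  multiplied by the marginal density — `termRepr_cpl_of_jointLaw`, i.e. `T4TermReprCoupling.termRepr_cpl_of_disintegration` with
  its three structural demands (product form, finiteness, absolute continuity) DISCHARGED from `HaarAC` by name.  What it does NOT
  do: identify run B's actual per-term reference of [Balaban1988RG2] (1.99)/(1.100) with such a joint law (that is the cell's
  node-U5d/U0 typing, still owed — record §14), nor RE-prove `HaarAC` for Bałaban's block averaging — it is CONSUMED BY NAME
  from the tree where available (`BlockAveragingEMLFibreLawSUN.haarAC_avgFun_expMeanLogSU_SUN`, the exp-mean-log averaging on
  `SU(N)`, §2b/§3b; the projected-mean averaging on `SU(2)` has it only under the recorded hypotheses of `BlockAveragingHaarAC`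
  and is not instantiated here), nor touch the MULTI-step tower (run B's reference in the η-dictionary is the whole run-A tower
  times ONE finest fibre; here `Ω_A` is a single coarse level — the first rung only).
* §3b: the same on `SU(N)` with Bałaban's exp-mean-log block averaging, unconditional in the standing range
  (`termRepr_cpl_of_blockAvg_SUN`).
* §4 SANITY: the generic layer fires on a one-point toy; the gauge layer fires for the axial (decimation) averaging of
  `AveragingRT` on any standard Borel gauge group in the standing range (Haar-compatible, hence `HaarAC`).
* §5 (v1.1) THE TRAJECTORY PRESENTATION — the «single coarse level» of §3 relaxed for the PURE δ-CONSTRAINT SKELETON of a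
  multi-step run (every coarser field a deterministic measurable function of the finest common field): run A's per-term
  reference presented on ANY measurable space `Ω_A` as the image `(dV).map Tr` of its finest-common-level product Haar measure
  under a measurable tower map `Tr`, run B's reference the joint law of `(Tr Ū, U)`; `termRepr_cpl_of_jointLaw_traj` — the
  disintegration constructor with ONLY the finest step's `HaarAC` (a.c. transfers along `Tr`: `absolutelyContinuous_map_comp`;
  coarser steps, common to both runs, need nothing); `termRepr_pullback` (a `TermRepr` against push-forward references is one
  against the original references with everything composed); the two-level tower `termRepr_cpl_of_jointLaw_tower2` (second
  averaging merely measurable) and its `SU(N)` exp-mean-log version `termRepr_cpl_of_blockAvg_SUN_tower2`.  NOT covered: the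
  auxiliary fluctuation / background variables a term's operations integrate (node-U5d/U0 typing, owed item (o1)).
* §6 (v1.2) THE WINDOW PRESENTATION — design (W), the cell referee's reading F6 (c): the space of the ledger's pointwise remainder
  sandwich is the WINDOW (the gauge field at the term's oldest YOUNG level, one finite lattice common to both runs and independent
  of the cutoff), and every OLDER integration — in BOTH runs; run B's extra level is the oldest, hence among them — is PERFORMED and
  enters the remainder as a VALUE: `perfDensity` (the Radon–Nikodym density of the image of the weighted finest-level measure under
  the old tower map), its push-forward identity `integral_perfDensity_mul`, the constructor `termRepr_performed` (converse companion
  of `termRepr_pullback`: both runs land on ONE reference, `cauchy_of_repr` applies with no coupling in between), the exact `k`-step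
  tower map `towerMap` with ITERATED `HaarAC` (`towerAC`, on `SU(N)` with exp-mean-log averaging unconditional in the standing
  range: `towerAC_expMeanLogSU_SUN`), the relabelling step `absolutelyContinuous_map_comp_of_map`, and the assembled
  `termRepr_window` / `termRepr_window_SUN`.  The earlier sections are thereby re-scoped, not withdrawn: §3/§5's couplings along
  the finest fibre are tools INSIDE performed integrals (for whoever proves the sandwich), not the typing of the window.  NOT covered,
  as before: the young auxiliary variables, undeclared young factors and old weight of a printed term (owed item (o1)), the
  relabelling of the two runs' equal lattices (owed item (o6)), any estimate.
* §7 (v1.3) THE RELABELLING (owed item (o6)) — `relabel ε U := U ∘ ε` along any equivalence `ε` of bond index types is measurable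
  and carries product Haar measure to product Haar measure EXACTLY (`map_relabel_fieldMeasure`, Mathlib `measurePreserving_piCongrLeft`),
  so §6's `he` / `heμ` are discharged (`termRepr_window_relabel`, `termRepr_window_SUN_relabel`); the canonical geometric equivalence
  of two levels with equal dimension and equal site count (`siteEquiv`, `bondEquiv`, a torus isomorphism: `siteEquiv_shift`,
  `bondEquiv_tgt`), the window record `window P N_W := ⟨d, L, m, N_W⟩` (it does not mention `P.K`: `window_eq_of_eq`), the
  numerology `sitesPerDir_window` and `windowBondEquiv`.  Still owed of (o6): only the bookkeeping that a printed term's young slot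
  variables on the window lattice are the relabelled further averages (compatibility of `Setup.blockOf`/`emb` with `siteEquiv`).
-/

open MeasureTheory ProbabilityTheory
open scoped ENNReal NNReal

namespace Literature.MathematicalPhysics.QuantumFieldTheory.Balaban1983to89.T4AveragingDisintegration

open T4TermReprCoupling

noncomputable section

/-! ## §1 GENERIC: joint law of `(avg U, U)`, conditional kernel, marginal density, kernel transport -/

section Generic

variable {α β : Type*} [MeasurableSpace α] [MeasurableSpace β]

/-- The joint law of `(avg U, U)` under `ν`: the one-step reference IN PRODUCT FORM (coarse coordinate first). [folklore] -/
def jointLaw (ν : Measure β) (avg : β → α) : Measure (α × β) := ν.map (fun U => (avg U, U))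

/-- The graph map `U ↦ (avg U, U)` is measurable for a measurable `avg`. [folklore] -/
theorem measurable_graphMap {avg : β → α} (havg : Measurable avg) : Measurable (fun U : β => (avg U, U)) :=
  havg.prodMk measurable_id

/-- The joint law of a finite measure is finite. [folklore] -/
instance isFiniteMeasure_jointLaw (ν : Measure β) [IsFiniteMeasure ν] (avg : β → α) : IsFiniteMeasure (jointLaw ν avg) := by
  unfold jointLaw; infer_instance

/-- First marginal of the joint law = the push-forward `ν.map avg`. [folklore] -/
theorem jointLaw_fst (ν : Measure β) {avg : β → α} (havg : Measurable avg) : (jointLaw ν avg).fst = ν.map avg := by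
  rw [Measure.fst, jointLaw, Measure.map_map measurable_fst (measurable_graphMap havg)]
  rfl

/-- Second marginal of the joint law = `ν` itself. [folklore] -/
theorem jointLaw_snd (ν : Measure β) {avg : β → α} (havg : Measurable avg) : (jointLaw ν avg).snd = ν := by
  rw [Measure.snd, jointLaw, Measure.map_map measurable_snd (measurable_graphMap havg)]
  exact Measure.map_id'

/-- Integration against the joint law = integration of `g(avg U, U)` against `ν`. [folklore] -/
theorem integral_jointLaw (ν : Measure β) {avg : β → α} (havg : Measurable avg) {g : α × β → ℝ}
    (hg : AEStronglyMeasurable g (jointLaw ν avg)) :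
    ∫ z, g z ∂(jointLaw ν avg) = ∫ U, g (avg U, U) ∂ν :=
  integral_map (measurable_graphMap havg).aemeasurable hg

/-- Integrability against the joint law = integrability of `g(avg U, U)` against `ν`. [folklore] -/
theorem integrable_jointLaw_iff (ν : Measure β) {avg : β → α} (havg : Measurable avg) {g : α × β → ℝ}
    (hg : AEStronglyMeasurable g (jointLaw ν avg)) :
    Integrable g (jointLaw ν avg) ↔ Integrable (fun U => g (avg U, U)) ν :=
  integrable_map_measure hg (measurable_graphMap havg).aemeasurable

/-- A `ν`-a.e. strongly measurable function of the fine variable is a.e. strongly measurable on the joint law. [folklore] -/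
theorem aestronglyMeasurable_comp_snd_jointLaw (ν : Measure β) {avg : β → α} (havg : Measurable avg) {ρ : β → ℝ}
    (hρ : AEStronglyMeasurable ρ ν) : AEStronglyMeasurable (fun z : α × β => ρ z.2) (jointLaw ν avg) := by
  have h : AEStronglyMeasurable ρ ((jointLaw ν avg).map Prod.snd) := by
    have e : (jointLaw ν avg).map Prod.snd = ν := jointLaw_snd ν havg
    rw [e]; exact hρ
  exact h.comp_measurable measurable_snd

/-- THE JOINT LAW IS CARRIED BY THE GRAPH `{z | z.1 = avg z.2}` (measurable when the coarse space has a measurable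
diagonal). [folklore] -/
theorem jointLaw_graph_compl (ν : Measure β) {avg : β → α} (havg : Measurable avg) [MeasurableEq α] :
    jointLaw ν avg {z : α × β | z.1 = avg z.2}ᶜ = 0 := by
  have hs : MeasurableSet {z : α × β | z.1 = avg z.2} :=
    measurableSet_eq_fun measurable_fst (havg.comp measurable_snd)
  rw [jointLaw, Measure.map_apply (measurable_graphMap havg) hs.compl]
  have : (fun U : β => (avg U, U)) ⁻¹' {z : α × β | z.1 = avg z.2}ᶜ = ∅ := by
    ext U; simp
  rw [this, measure_empty]

/-- The marginal density `d(avg_* ν)/dμ` of the coarse coordinate, as an `ℝ≥0`-valued measurable function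
(`T4TermReprCoupling.rnNN`). [folklore] -/
def margDensity (ν : Measure β) (μ : Measure α) (avg : β → α) : α → ℝ≥0 := rnNN (jointLaw ν avg).fst μ

/-- Measurability of the marginal density. [folklore] -/
theorem measurable_margDensity {ν : Measure β} {μ : Measure α} {avg : β → α} : Measurable (margDensity ν μ avg) :=
  measurable_rnNN _ _

/-- Under absolute continuity the marginal density recovers the coarse marginal: `μ.withDensity h = (jointLaw).fst`.
[folklore] -/
theorem withDensity_margDensity_eq_fst (ν : Measure β) [IsFiniteMeasure ν] (μ : Measure α) [SigmaFinite μ] {avg : β → α}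
    (havg : Measurable avg) (hac : ν.map avg ≪ μ) :
    μ.withDensity (fun V => (margDensity ν μ avg V : ℝ≥0∞)) = (jointLaw ν avg).fst := by
  have h : (jointLaw ν avg).fst ≪ μ := by rw [jointLaw_fst ν havg]; exact hac
  exact withDensity_rnNN_eq _ μ h

/-- … hence `μ.withDensity h = ν.map avg`. [folklore] -/
theorem withDensity_margDensity (ν : Measure β) [IsFiniteMeasure ν] (μ : Measure α) [SigmaFinite μ] {avg : β → α}
    (havg : Measurable avg) (hac : ν.map avg ≪ μ) :
    μ.withDensity (fun V => (margDensity ν μ avg V : ℝ≥0∞)) = ν.map avg := by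
  rw [withDensity_margDensity_eq_fst ν μ havg hac, jointLaw_fst ν havg]

variable [StandardBorelSpace β] [Nonempty β]

/-- THE CONDITIONAL KERNEL of the fine variable given the coarse one («the law of `U` given `Ū = V`»): the conditional
kernel of the joint law (`Measure.condKernel`; standard Borel non-empty fine space). [folklore] -/
def condLaw (ν : Measure β) [IsFiniteMeasure ν] (avg : β → α) : Kernel α β := (jointLaw ν avg).condKernel

/-- The conditional kernel is Markov. [folklore] -/
instance isMarkovKernel_condLaw (ν : Measure β) [IsFiniteMeasure ν] (avg : β → α) : IsMarkovKernel (condLaw ν avg) := by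
  unfold condLaw; infer_instance

/-- Disintegration over the coarse marginal: `(jointLaw).fst ⊗ₘ condLaw = jointLaw` (`Measure.disintegrate`). [folklore] -/
theorem fst_compProd_condLaw (ν : Measure β) [IsFiniteMeasure ν] (avg : β → α) :
    (jointLaw ν avg).fst ⊗ₘ condLaw ν avg = jointLaw ν avg :=
  (jointLaw ν avg).disintegrate (jointLaw ν avg).condKernel

/-- **THE KERNEL FORM OF `δ(ŪV⁻¹)`**: for `(ν.map avg)`-almost every coarse configuration `V` the conditional kernel gives
full mass to the fibre `{U | avg U = V}`. [folklore] -/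
theorem condLaw_fibre_ae (ν : Measure β) [IsFiniteMeasure ν] {avg : β → α} (havg : Measurable avg) [MeasurableEq α] :
    ∀ᵐ V ∂(ν.map avg), condLaw ν avg V {U | avg U = V} = 1 := by
  have hs : MeasurableSet {z : α × β | z.1 = avg z.2} :=
    measurableSet_eq_fun measurable_fst (havg.comp measurable_snd)
  have h0 : ((jointLaw ν avg).fst ⊗ₘ condLaw ν avg) {z : α × β | z.1 = avg z.2}ᶜ = 0 := by
    rw [fst_compProd_condLaw]; exact jointLaw_graph_compl ν havg
  rw [Measure.compProd_apply hs.compl,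
    lintegral_eq_zero_iff (Kernel.measurable_kernel_prodMk_left hs.compl)] at h0
  rw [← jointLaw_fst ν havg]
  filter_upwards [h0] with V hV
  have hsV : MeasurableSet {U : β | avg U = V} := measurableSet_eq_fun havg measurable_const
  have e : Prod.mk V ⁻¹' {z : α × β | z.1 = avg z.2}ᶜ = {U : β | avg U = V}ᶜ := by
    ext U; simp [eq_comm]
  have hV' : condLaw ν avg V {U : β | avg U = V}ᶜ = 0 := by
    rw [← e]; simpa using hV
  exact (prob_compl_eq_zero_iff hsV).1 hV'

/-- **THE DISINTEGRATION** of the one-step reference: `(μ.withDensity h) ⊗ₘ condLaw = jointLaw` under `ν.map avg ≪ μ`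
(`T4TermReprCoupling.withDensity_compProd_condKernel` by name). [folklore] -/
theorem disintegration (ν : Measure β) [IsFiniteMeasure ν] (μ : Measure α) [SigmaFinite μ] {avg : β → α}
    (havg : Measurable avg) (hac : ν.map avg ≪ μ) :
    μ.withDensity (fun V => (margDensity ν μ avg V : ℝ≥0∞)) ⊗ₘ condLaw ν avg = jointLaw ν avg := by
  have h : (jointLaw ν avg).fst ≪ μ := by rw [jointLaw_fst ν havg]; exact hac
  exact withDensity_compProd_condKernel (jointLaw ν avg) μ h

/-- The same disintegration with the density moved onto the product: `jointLaw = (μ ⊗ₘ condLaw).withDensity (h ∘ fst)`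
(`T4TermReprCoupling.withDensity_compProd_left`). [folklore] -/
theorem jointLaw_eq_withDensity_compProd (ν : Measure β) [IsFiniteMeasure ν] (μ : Measure α) [SigmaFinite μ] {avg : β → α}
    (havg : Measurable avg) (hac : ν.map avg ≪ μ) :
    jointLaw ν avg = (μ ⊗ₘ condLaw ν avg).withDensity (fun z => (margDensity ν μ avg z.1 : ℝ≥0∞)) := by
  have hm : Measurable fun V => (margDensity ν μ avg V : ℝ≥0∞) := measurable_margDensity.coe_nnreal_ennreal
  rw [← withDensity_compProd_left (μ := μ) (κ := condLaw ν avg) (h := fun V => (margDensity ν μ avg V : ℝ≥0∞)) hm]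
  exact (disintegration ν μ havg hac).symm

/-- An integrable function of the joint law, multiplied by the marginal density of the coarse coordinate, is integrable for
`μ ⊗ₘ condLaw`. [folklore] -/
theorem integrable_margDensity_mul (ν : Measure β) [IsFiniteMeasure ν] (μ : Measure α) [SigmaFinite μ] {avg : β → α}
    (havg : Measurable avg) (hac : ν.map avg ≪ μ) {g : α × β → ℝ} (hgi : Integrable g (jointLaw ν avg)) :
    Integrable (fun z : α × β => (margDensity ν μ avg z.1 : ℝ) * g z) (μ ⊗ₘ condLaw ν avg) := by
  have hm : Measurable fun z : α × β => margDensity ν μ avg z.1 := measurable_margDensity.comp measurable_fst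
  rw [jointLaw_eq_withDensity_compProd ν μ havg hac] at hgi
  have h := (integrable_withDensity_iff_integrable_smul hm).1 hgi
  simpa [NNReal.smul_def, smul_eq_mul] using h

/-- **THE RENORMALIZATION TRANSFORMATION AS A DISINTEGRATION, integrated form**: for `g` integrable along the graph,
`∫ g(avg U, U) dν(U) = ∫ h(V) · (∫ g(V, U) condLaw(V, dU)) dμ(V)`. [folklore] -/
theorem integral_graph_eq (ν : Measure β) [IsFiniteMeasure ν] (μ : Measure α) [SigmaFinite μ] {avg : β → α}
    (havg : Measurable avg) (hac : ν.map avg ≪ μ) {g : α × β → ℝ}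
    (hgm : AEStronglyMeasurable g (jointLaw ν avg)) (hg : Integrable (fun U => g (avg U, U)) ν) :
    ∫ U, g (avg U, U) ∂ν = ∫ V, (margDensity ν μ avg V : ℝ) * ∫ U, g (V, U) ∂(condLaw ν avg V) ∂μ := by
  have hgi : Integrable g (jointLaw ν avg) := (integrable_jointLaw_iff ν havg hgm).2 hg
  have hI := integrable_margDensity_mul ν μ havg hac hgi
  have hm : Measurable fun z : α × β => margDensity ν μ avg z.1 := measurable_margDensity.comp measurable_fst
  rw [← integral_jointLaw ν havg hgm]
  have hgi' : Integrable g ((μ ⊗ₘ condLaw ν avg).withDensity fun z => (margDensity ν μ avg z.1 : ℝ≥0∞)) := by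
    rw [← jointLaw_eq_withDensity_compProd ν μ havg hac]; exact hgi
  rw [jointLaw_eq_withDensity_compProd ν μ havg hac, integral_withDensity_eq_integral_smul hm]
  simp only [NNReal.smul_def, smul_eq_mul]
  exact integral_compProd_mul_fst (g := fun V => (margDensity ν μ avg V : ℝ)) (f := g) hI

/-- **THE KERNEL TRANSPORT** of a density `ρ` of the fine field: `(Tρ)(V) := h(V) · ∫ ρ(U) condLaw(V, dU)`. [folklore] -/
def kernelTransport (ν : Measure β) [IsFiniteMeasure ν] (μ : Measure α) (avg : β → α) (ρ : β → ℝ) : α → ℝ :=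
  fun V => (margDensity ν μ avg V : ℝ) * ∫ U, ρ U ∂(condLaw ν avg V)

/-- The kernel transport preserves positivity (for every `ρ ≥ 0`, integrable or not). [folklore] -/
theorem kernelTransport_nonneg {ν : Measure β} [IsFiniteMeasure ν] {μ : Measure α} {avg : β → α} {ρ : β → ℝ}
    (h0 : ∀ U, 0 ≤ ρ U) (V : α) : 0 ≤ kernelTransport ν μ avg ρ V :=
  mul_nonneg (margDensity ν μ avg V).coe_nonneg (integral_nonneg h0)

/-- **THE PUSH-FORWARD IDENTITY** (the shape of `Setup.IsRT`): for integrable `ρ` and bounded measurable `f`,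
`∫ (Tρ)(V) f(V) dμ(V) = ∫ ρ(U) f(avg U) dν(U)`. [folklore] -/
theorem integral_kernelTransport_mul (ν : Measure β) [IsFiniteMeasure ν] (μ : Measure α) [SigmaFinite μ] {avg : β → α}
    (havg : Measurable avg) (hac : ν.map avg ≪ μ) {ρ : β → ℝ} (hρ : Integrable ρ ν) {f : α → ℝ} (hf : Measurable f)
    {C : ℝ} (hC : ∀ V, |f V| ≤ C) :
    ∫ V, kernelTransport ν μ avg ρ V * f V ∂μ = ∫ U, ρ U * f (avg U) ∂ν := by
  have hfb : ∀ U, ‖f (avg U)‖ ≤ C := fun U => by simpa [Real.norm_eq_abs] using hC (avg U)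
  have hI : Integrable (fun U => ρ U * f (avg U)) ν :=
    hρ.mul_bdd (hf.comp havg).aestronglyMeasurable (Filter.Eventually.of_forall hfb)
  have hgm : AEStronglyMeasurable (fun z : α × β => ρ z.2 * f z.1) (jointLaw ν avg) :=
    (aestronglyMeasurable_comp_snd_jointLaw ν havg hρ.1).mul (hf.comp measurable_fst).aestronglyMeasurable
  have key := integral_graph_eq ν μ havg hac (g := fun z : α × β => ρ z.2 * f z.1) hgm hI
  rw [key]
  refine integral_congr_ae (ae_of_all _ fun V => ?_)
  simp only [kernelTransport]
  rw [integral_mul_const]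
  ring

/-- The kernel transport of an integrable density is integrable. [folklore] -/
theorem integrable_kernelTransport (ν : Measure β) [IsFiniteMeasure ν] (μ : Measure α) [SigmaFinite μ] {avg : β → α}
    (havg : Measurable avg) (hac : ν.map avg ≪ μ) {ρ : β → ℝ} (hρ : Integrable ρ ν) :
    Integrable (kernelTransport ν μ avg ρ) μ := by
  have hgm : AEStronglyMeasurable (fun z : α × β => ρ z.2) (jointLaw ν avg) :=
    aestronglyMeasurable_comp_snd_jointLaw ν havg hρ.1
  have hgi : Integrable (fun z : α × β => ρ z.2) (jointLaw ν avg) := (integrable_jointLaw_iff ν havg hgm).2 hρ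
  have hI := (integrable_margDensity_mul ν μ havg hac hgi).integral_compProd
  refine hI.congr (ae_of_all _ fun V => ?_)
  simp only [kernelTransport]
  exact integral_const_mul _ _

omit [StandardBorelSpace β] [Nonempty β] in
/-- **A.E. UNIQUENESS OF THE TRANSFORM**: two `μ`-integrable densities with the same integrals against every bounded measurable
test function agree `μ`-a.e. (test with indicators of measurable sets). [folklore] -/
theorem ae_eq_of_forall_integral_mul_eq {μ : Measure α} {ρ₁ ρ₂ : α → ℝ} (h₁ : Integrable ρ₁ μ) (h₂ : Integrable ρ₂ μ)
    (h : ∀ f : α → ℝ, Measurable f → (∃ C : ℝ, ∀ V, |f V| ≤ C) →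
      ∫ V, ρ₁ V * f V ∂μ = ∫ V, ρ₂ V * f V ∂μ) :
    ρ₁ =ᵐ[μ] ρ₂ := by
  refine Integrable.ae_eq_of_forall_setIntegral_eq ρ₁ ρ₂ h₁ h₂ fun s hs _ => ?_
  have key := h (s.indicator fun _ => (1 : ℝ)) (measurable_const.indicator hs)
    ⟨1, fun V => by by_cases hV : V ∈ s <;> simp [hV]⟩
  have e : ∀ ρ : α → ℝ, (fun V => ρ V * s.indicator (fun _ => (1 : ℝ)) V) = s.indicator ρ := by
    intro ρ; funext V; by_cases hV : V ∈ s <;> simp [hV]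
  rw [e ρ₁, e ρ₂, integral_indicator hs, integral_indicator hs] at key
  exact key

end Generic

/-! ## §2 GAUGE FIELDS: `HaarAC` ⇒ the kernel transport is a renormalization transform (`Setup.IsRT`), an `RTOpI` -/

section Gauge

open T4FiniteEpsInhabited AveragingRT

variable {P : Params} {j : ℕ} {G : Type*} [GaugeGroup G] [MeasurableSpace G] [HaarData G]

/-- The configuration space `GaugeField P j G = (PBond P j → G)` of a standard Borel gauge group is standard Borel (finite
product; Mathlib's `StandardBorelSpace.pi_countable`). [folklore] -/
instance standardBorelSpace_gaugeField [StandardBorelSpace G] : StandardBorelSpace (GaugeField P j G) :=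
  inferInstanceAs (StandardBorelSpace (PBond P j → G))

/-- `HaarAC avg` is literally absolute continuity of the push-forward of product Haar measure. [folklore] -/
theorem haarAC_iff (avg : GaugeField P j G → GaugeField P (j+1) G) :
    HaarAC avg ↔ (fieldMeasure P j G).map avg ≪ fieldMeasure P (j+1) G := Iff.rfl

variable [StandardBorelSpace G]

/-- THE AVERAGING KERNEL of one step: the conditional law of the fine field `U` given the coarse field `Ū = V`
(`condLaw` of `dU` along `avg`). [folklore] -/
abbrev avgKernel (avg : GaugeField P j G → GaugeField P (j+1) G) : Kernel (GaugeField P (j+1) G) (GaugeField P j G) :=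
  condLaw (fieldMeasure P j G) avg

/-- THE MARGINAL DENSITY `d(avg_* dU)/dV` of one step. [folklore] -/
abbrev avgDensity (avg : GaugeField P j G → GaugeField P (j+1) G) : GaugeField P (j+1) G → ℝ≥0 :=
  margDensity (fieldMeasure P j G) (fieldMeasure P (j+1) G) avg

/-- THE KERNEL TRANSPORT of one step on densities of the gauge field. [folklore] -/
abbrev transportK (avg : GaugeField P j G → GaugeField P (j+1) G) (ρ : Density P j G) : Density P (j+1) G :=
  kernelTransport (fieldMeasure P j G) (fieldMeasure P (j+1) G) avg ρ

/-- For `dŪ`-almost every coarse field the averaging kernel lives on the fibre `{U | Ū = V}` — the kernel form of the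
constraint `δ(ŪV⁻¹)` (only `(dU.map avg)`-a.e.: where the marginal density vanishes the kernel is unconstrained and unused).
[folklore] -/
theorem avgKernel_fibre_ae {avg : GaugeField P j G → GaugeField P (j+1) G} (havg : Measurable avg) :
    ∀ᵐ V ∂((fieldMeasure P j G).map avg), avgKernel avg V {U | avg U = V} = 1 :=
  condLaw_fibre_ae _ havg

/-- THE ONE-STEP DISINTEGRATION on gauge fields: `(dV.withDensity h) ⊗ₘ avgKernel = jointLaw dU avg` under `HaarAC`. [folklore] -/
theorem disintegration_fieldMeasure {avg : GaugeField P j G → GaugeField P (j+1) G} (havg : Measurable avg)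
    (hac : HaarAC avg) :
    (fieldMeasure P (j+1) G).withDensity (fun V => (avgDensity avg V : ℝ≥0∞)) ⊗ₘ avgKernel avg
      = jointLaw (fieldMeasure P j G) avg :=
  disintegration _ _ havg hac

/-- **THE KERNEL TRANSPORT IS A RENORMALIZATION TRANSFORM** in the cell's sense `Setup.IsRT` (the push-forward reading of
`(Tρ)(V) = ∫ dU δ(ŪV⁻¹) ρ(U)`), for every integrable density, along every measurable averaging with `HaarAC`. [folklore] -/
theorem isRT_kernelTransport {avg : GaugeField P j G → GaugeField P (j+1) G} (havg : Measurable avg) (hac : HaarAC avg)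
    (ρ : Density P j G) (hρ : Integrable ρ (fieldMeasure P j G)) : IsRT avg ρ (transportK avg ρ) := by
  intro f hf hfC
  obtain ⟨C, hC⟩ := hfC
  exact integral_kernelTransport_mul _ _ havg hac hρ hf hC

/-- **AN `RTOpI` INHABITANT BY DISINTEGRATION** (sibling of `T4FiniteEpsInhabited.rtOpIOfAC`): one kernel transports every
integrable density and preserves positivity. [folklore] -/
def rtOpIOfKernel (av : Averaging P j G) (havg : Measurable av.avg) (hac : HaarAC av.avg) : RTOpI P j G av where
  T := transportK av.avg
  isRT := fun ρ hρ => isRT_kernelTransport havg hac ρ hρ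
  pos := fun _ h0 V => kernelTransport_nonneg h0 V

/-- The kernel transport and the Radon–Nikodym transport `AveragingRT.rnTransport` of an integrable density agree `dV`-a.e.
(both satisfy `IsRT`; a.e. uniqueness). [folklore] -/
theorem kernelTransport_ae_eq_rnTransport {avg : GaugeField P j G → GaugeField P (j+1) G} (havg : Measurable avg)
    (hac : HaarAC avg) (ρ : Density P j G) (hρ : Integrable ρ (fieldMeasure P j G)) :
    transportK avg ρ =ᵐ[fieldMeasure P (j+1) G] rnTransport avg ρ :=
  ae_eq_of_forall_integral_mul_eq (integrable_kernelTransport _ _ havg hac hρ)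
    (integrable_rnTransport_of_ac avg havg hac ρ hρ) fun f hf hC => by
      rw [isRT_kernelTransport havg hac ρ hρ f hf hC, isRT_rnTransport_of_ac avg havg hac ρ hρ f hf hC]

end Gauge

/-! ## §2b `SU(N)`: a standard Borel gauge group; Bałaban's exp-mean-log block averaging (0.4) carries the kernel transport -/

section SUN

open T4FiniteEpsInhabited BlockAveraging ExpMeanLog BlockAveragingEMLFibreLawSUN

variable {N : ℕ}

/-- `SU(N)` is a closed subset of the `N × N` complex matrices (it is compact — tree `Matrix.specialUnitaryGroup.instCompactSpace`
of `QuantumLattice.GaugeGroups` — in a Hausdorff space). [folklore] -/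
theorem isClosed_specialUnitaryGroup_coe :
    IsClosed (↑(Matrix.specialUnitaryGroup (Fin N) ℂ) : Set (Matrix (Fin N) (Fin N) ℂ)) :=
  (isCompact_iff_compactSpace.mpr
    (inferInstanceAs (CompactSpace (Matrix.specialUnitaryGroup (Fin N) ℂ)))).isClosed

/-- `SU(N)` is a Polish space (closed subset of the Polish space of matrices = a finite product of copies of `ℂ`). [folklore] -/
theorem polishSpace_specialUnitaryGroup : PolishSpace (Matrix.specialUnitaryGroup (Fin N) ℂ) := by
  haveI : PolishSpace (Matrix (Fin N) (Fin N) ℂ) := inferInstanceAs (PolishSpace (Fin N → Fin N → ℂ))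
  exact isClosed_specialUnitaryGroup_coe.polishSpace

/-- `SU(N)` with its Borel σ-algebra (tree `Matrix.specialUnitaryGroup.instMeasurableSpace` / `instBorelSpace`) is a STANDARD
BOREL space — so `Measure.condKernel` is available on `SU(N)`-valued gauge fields (`standardBorelSpace_gaugeField`). [folklore] -/
instance standardBorelSpace_specialUnitaryGroup : StandardBorelSpace (Matrix.specialUnitaryGroup (Fin N) ℂ) := by
  haveI := polishSpace_specialUnitaryGroup (N := N)
  infer_instance

variable [NeZero N]

/-- **BAŁABAN'S BLOCK AVERAGING (0.4) ON `SU(N)` AS ONE MARKOV KERNEL**: in the standing range `j + 1 ≤ m + K`, the block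
averaging with the exp-mean-log small-loop average (`BlockAveraging.blockAvg ExpMeanLog.expMeanLogSU`; measurable by
`BlockAveraging.measurable_avgFun`, `HaarAC` by `BlockAveragingEMLFibreLawSUN.haarAC_avgFun_expMeanLogSU_SUN`) carries the
renormalization transformation `rtOpIOfKernel`: EVERY integrable density is transported by the ONE averaging kernel
`avgKernel (avgFun expMeanLogSU)` times the ONE marginal density `avgDensity (avgFun expMeanLogSU)`.  (This is an `RTOpI`
inhabitant in the cell's sense `Setup.IsRT`; it proves nothing about the printed densities.) [folklore] -/
def rtOpI_blockAvg_expMeanLogSU {P : Params} {j : ℕ} (hj : j + 1 ≤ P.m + P.K) :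
    RTOpI P j (Matrix.specialUnitaryGroup (Fin N) ℂ)
      (blockAvg (expMeanLogSU : LoopAverage (Matrix.specialUnitaryGroup (Fin N) ℂ))) :=
  rtOpIOfKernel _ (measurable_avgFun _ measurable_expMeanLogSU_E) (haarAC_avgFun_expMeanLogSU_SUN hj)

/-- … and its averaging kernel lives on the fibres `{U | Ū = V}` for `dŪ`-a.e. `V` (the kernel form of `∏_c δ(Ū(c)V(c)⁻¹)`).
[folklore] -/
theorem avgKernel_expMeanLogSU_fibre_ae {P : Params} {j : ℕ} :
    ∀ᵐ V ∂((fieldMeasure P j (Matrix.specialUnitaryGroup (Fin N) ℂ)).map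
        (avgFun (expMeanLogSU : LoopAverage (Matrix.specialUnitaryGroup (Fin N) ℂ)))),
      avgKernel (avgFun (expMeanLogSU : LoopAverage (Matrix.specialUnitaryGroup (Fin N) ℂ))) V
        {U | avgFun expMeanLogSU U = V} = 1 :=
  avgKernel_fibre_ae (measurable_avgFun _ measurable_expMeanLogSU_E)

end SUN

/-! ## §3 THE η-DICTIONARY AT ONE STEP: `termRepr_cpl_of_disintegration` with its demands discharged from `HaarAC` -/

section OneStep

open T4LipschitzLedger T4FiniteEpsInhabited

variable {ι : Type*} {G : Type*} [GaugeGroup G] [MeasurableSpace G] [HaarData G] [StandardBorelSpace G]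
  (Pf : ℕ → ι → Params) (lvl : ℕ → ι → ℕ)

/-- Coarse configuration space of term `(K, τ)`: gauge fields one level up. [folklore] -/
abbrev ΩC : ℕ → ι → Type _ := fun K τ => GaugeField (Pf K τ) (lvl K τ + 1) G

/-- Fine configuration space of term `(K, τ)`. [folklore] -/
abbrev ΩFine : ℕ → ι → Type _ := fun K τ => GaugeField (Pf K τ) (lvl K τ) G

variable {Pf lvl}
  {l₀ : ℝ} {T : ℕ → Finset ι} {B : ℕ → ℝ → ι → ℝ} {χ : ℕ → ℝ → ℝ} {κ Lχ : ℕ → ℝ} {N : ℕ} {n : ℕ → ℕ}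
  {m : ℕ → ι → ℕ} {slot : ℕ → ι → ℕ → Σ _ : ℕ, ℕ} {pol : ℕ → ι → ℕ → Pol} {θ : ℕ → ι → ℕ → ℝ}
  {uB uZ : (K : ℕ) → (τ : ι) → ℕ → ΩC (G := G) Pf lvl K τ × ΩFine (G := G) Pf lvl K τ → ℝ}
  {RB : (K : ℕ) → ℝ → (τ : ι) → ΩC (G := G) Pf lvl K τ × ΩFine (G := G) Pf lvl K τ → ℝ}

/-- **ONE-STEP INSTANCE OF THE DISINTEGRATION CONSTRUCTOR.**  For a family of measurable one-step averagings `avg K τ` with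
`HaarAC`, a run-B `TermRepr` against the joint laws `jointLaw dU (avg K τ)` (product form: coarse field × fine field) is a
`TermRepr` against `cpl dV (fibOf jointLaw)` — coarse product Haar measure ⊗ₘ the averaging kernels — with the remainder
multiplied by the marginal densities: `T4TermReprCoupling.termRepr_cpl_of_disintegration` with finiteness, standard Borel fibre
and absolute continuity ALL discharged (`isFiniteMeasure_jointLaw`, `standardBorelSpace_gaugeField`, `jointLaw_fst` + `HaarAC`).
[folklore] -/
theorem termRepr_cpl_of_jointLaw
    (avg : (K : ℕ) → (τ : ι) → ΩFine (G := G) Pf lvl K τ → ΩC (G := G) Pf lvl K τ)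
    (havg : ∀ K τ, Measurable (avg K τ)) (hac : ∀ K τ, HaarAC (avg K τ))
    (hB : TermRepr l₀ T B χ κ Lχ N n (fun K τ => jointLaw (fieldMeasure (Pf K τ) (lvl K τ) G) (avg K τ))
      m slot pol θ uB uZ RB) :
    TermRepr l₀ T B χ κ Lχ N n
      (cpl (fun K τ => fieldMeasure (Pf K τ) (lvl K τ + 1) G)
        (fibOf fun K τ => jointLaw (fieldMeasure (Pf K τ) (lvl K τ) G) (avg K τ)))
      m slot pol θ uB uZ
      (fun K t τ z => (hdOf (fun K τ => jointLaw (fieldMeasure (Pf K τ) (lvl K τ) G) (avg K τ))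
        (fun K τ => fieldMeasure (Pf K τ) (lvl K τ + 1) G) K τ z.1 : ℝ) * RB K t τ z) :=
  termRepr_cpl_of_disintegration _ (fun K τ => by rw [jointLaw_fst _ (havg K τ)]; exact hac K τ) hB

/-- … and the fibre kernel so obtained IS the averaging kernel of §2, the density the marginal density (by `rfl`). [folklore] -/
theorem fibOf_jointLaw (avg : (K : ℕ) → (τ : ι) → ΩFine (G := G) Pf lvl K τ → ΩC (G := G) Pf lvl K τ) (K : ℕ) (τ : ι) :
    fibOf (fun K τ => jointLaw (fieldMeasure (Pf K τ) (lvl K τ) G) (avg K τ)) K τ = avgKernel (avg K τ) ∧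
      hdOf (fun K τ => jointLaw (fieldMeasure (Pf K τ) (lvl K τ) G) (avg K τ))
        (fun K τ => fieldMeasure (Pf K τ) (lvl K τ + 1) G) K τ = avgDensity (avg K τ) :=
  ⟨rfl, rfl⟩

end OneStep

/-! ## §3b THE η-DICTIONARY AT ONE STEP ON `SU(N)` with Bałaban's exp-mean-log block averaging: nothing left to supply -/

section OneStepSUN

open T4LipschitzLedger T4FiniteEpsInhabited BlockAveraging ExpMeanLog BlockAveragingEMLFibreLawSUN

variable {ι : Type*} {N : ℕ} [NeZero N] (Pf : ℕ → ι → Params) (lvl : ℕ → ι → ℕ)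

/-- `SU(N)`. [folklore] -/
abbrev SU (N : ℕ) : Type := Matrix.specialUnitaryGroup (Fin N) ℂ

variable {Pf lvl}
  {l₀ : ℝ} {T : ℕ → Finset ι} {B : ℕ → ℝ → ι → ℝ} {χ : ℕ → ℝ → ℝ} {κ Lχ : ℕ → ℝ} {N₀ : ℕ} {n : ℕ → ℕ}
  {m : ℕ → ι → ℕ} {slot : ℕ → ι → ℕ → Σ _ : ℕ, ℕ} {pol : ℕ → ι → ℕ → Pol} {θ : ℕ → ι → ℕ → ℝ}
  {uB uZ : (K : ℕ) → (τ : ι) → ℕ → ΩC (G := SU N) Pf lvl K τ × ΩFine (G := SU N) Pf lvl K τ → ℝ}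
  {RB : (K : ℕ) → ℝ → (τ : ι) → ΩC (G := SU N) Pf lvl K τ × ΩFine (G := SU N) Pf lvl K τ → ℝ}

/-- **ONE-STEP DICTIONARY ON `SU(N)`, UNCONDITIONAL IN THE STANDING RANGE**: for terms `(K, τ)` run at levels
`lvl K τ + 1 ≤ m + K` of their tori, a run-B `TermRepr` against the joint laws of Bałaban's exp-mean-log block averaging is a
`TermRepr` against `cpl dV (fibOf jointLaw)` with remainder × marginal density — `termRepr_cpl_of_jointLaw` with measurability
and `HaarAC` supplied by the tree (`measurable_avgFun`, `haarAC_avgFun_expMeanLogSU_SUN`) and standard-Borelness by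
`standardBorelSpace_specialUnitaryGroup`. [folklore] -/
theorem termRepr_cpl_of_blockAvg_SUN (hr : ∀ K τ, lvl K τ + 1 ≤ (Pf K τ).m + (Pf K τ).K)
    (hB : TermRepr l₀ T B χ κ Lχ N₀ n
      (fun K τ => jointLaw (fieldMeasure (Pf K τ) (lvl K τ) (SU N))
        (avgFun (expMeanLogSU : LoopAverage (SU N)) : ΩFine (G := SU N) Pf lvl K τ → ΩC (G := SU N) Pf lvl K τ))
      m slot pol θ uB uZ RB) :
    TermRepr l₀ T B χ κ Lχ N₀ n
      (cpl (fun K τ => fieldMeasure (Pf K τ) (lvl K τ + 1) (SU N))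
        (fibOf fun K τ => jointLaw (fieldMeasure (Pf K τ) (lvl K τ) (SU N))
          (avgFun (expMeanLogSU : LoopAverage (SU N)) : ΩFine (G := SU N) Pf lvl K τ → ΩC (G := SU N) Pf lvl K τ)))
      m slot pol θ uB uZ
      (fun K t τ z => (hdOf (fun K τ => jointLaw (fieldMeasure (Pf K τ) (lvl K τ) (SU N))
          (avgFun (expMeanLogSU : LoopAverage (SU N)) : ΩFine (G := SU N) Pf lvl K τ → ΩC (G := SU N) Pf lvl K τ))
        (fun K τ => fieldMeasure (Pf K τ) (lvl K τ + 1) (SU N)) K τ z.1 : ℝ) * RB K t τ z) :=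
  termRepr_cpl_of_jointLaw (G := SU N) _ (fun _ _ => measurable_avgFun _ measurable_expMeanLogSU_E)
    (fun K τ => haarAC_avgFun_expMeanLogSU_SUN (hr K τ)) hB

end OneStepSUN

/-! ## §4 SANITY: the layers fire -/

namespace Sanity

/-- One-point toy: coarse = fine = `Unit`, `ν = μ = δ_()`, `avg = id`; the disintegration theorem fires. [folklore] -/
theorem disintegration_toy :
    (Measure.dirac ()).withDensity (fun V => (margDensity (Measure.dirac ()) (Measure.dirac ()) id V : ℝ≥0∞))
      ⊗ₘ condLaw (Measure.dirac ()) id = jointLaw (Measure.dirac ()) (id : Unit → Unit) :=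
  disintegration _ _ measurable_id (by rw [Measure.map_id])

/-- One-point toy: the push-forward identity fires (every `ρ : Unit → ℝ` is integrable, `f ≡ 1` is a bounded test). [folklore] -/
theorem transport_toy (ρ : Unit → ℝ) :
    ∫ V, kernelTransport (Measure.dirac ()) (Measure.dirac ()) id ρ V * (fun _ => (1 : ℝ)) V ∂(Measure.dirac ())
      = ∫ U, ρ U * (fun _ => (1 : ℝ)) (id U) ∂(Measure.dirac ()) :=
  integral_kernelTransport_mul _ _ measurable_id (by rw [Measure.map_id])
    (Integrable.of_finite) measurable_const (C := 1) (fun _ => by simp)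

open AveragingRT T4FiniteEpsInhabited in
/-- Gauge toy: on any standard Borel gauge group, in the standing range `j + 1 ≤ m + K`, the AXIAL (decimation) averaging of
`AveragingRT` is Haar-compatible, hence `HaarAC`, and `rtOpIOfKernel` inhabits `RTOpI P j G axial`. [folklore] -/
example {P : Params} {j : ℕ} {G : Type*} [GaugeGroup G] [MeasurableSpace G] [HaarData G] [MeasurableMul₂ G]
    [StandardBorelSpace G] (hj : j + 1 ≤ P.m + P.K) : RTOpI P j G axial :=
  rtOpIOfKernel axial measurable_axialAvg (haarAC_of_map_eq _ (map_axialAvg hj))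

end Sanity

/-! ## §5 (v1.1) THE TRAJECTORY PRESENTATION: run A's reference as ANY measurable image of its finest-common-level
product Haar measure — only the finest step's `HaarAC` is ever used

In the η-dictionary (record `t4/T4-EST-U5bE2.md` §13) run A's per-term reference space `Ω_A(K,τ)` is the WHOLE reference
space of the term, not one coarse level.  For the PURE δ-CONSTRAINT SKELETON of a multi-step run — every coarser field a
DETERMINISTIC measurable function of the finest common field `V` (successive averagings `V ↦ V̄ ↦ …`; the constraints of
`Setup.IsRT` are exact) — run A's reference is the image `(dV).map Tr` of the finest-common-level product Haar measure under a
measurable TOWER MAP `Tr : GaugeField P (j+1) G → Ω_A`, and run B's reference is the joint law of `(Tr (Ū), U)` under `dU`.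
The disintegration constructor then applies with NO input beyond the finest step's `HaarAC` (§5c): absolute continuity
transfers along the common map `Tr` (§5a), and the coarser steps — common to both runs — need nothing (not even `HaarAC`).
§5b records the companion bookkeeping fact that a `TermRepr` against push-forward references IS a `TermRepr` against the
original references with everything composed with the map (so a run presented on a trajectory space may equally be read on
its finest level).  NOT covered, and not claimed: the auxiliary fluctuation / background variables that a term's operations
integrate in [Balaban1988RG2] — their identification inside `Ω_A` is the cell's node-U5d/U0 typing (record §14–§15, owed
item (o1)); nothing printed is asserted here. -/

section GenericTraj

variable {α β γ : Type*} [MeasurableSpace α] [MeasurableSpace β] [MeasurableSpace γ]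

/-- Composing the averaging with a measurable map `T` of the coarse space maps the joint law along `Prod.map T id`.
[folklore] -/
theorem jointLaw_map_comp (ν : Measure β) {avg : β → α} (havg : Measurable avg) {T : α → γ} (hT : Measurable T) :
    (jointLaw ν avg).map (Prod.map T id) = jointLaw ν (T ∘ avg) := by
  unfold jointLaw
  rw [Measure.map_map (hT.prodMap measurable_id) (measurable_graphMap havg)]
  rfl

/-- Absolute continuity of the coarse marginal TRANSFERS along a common measurable map of the coarse space (Mathlib
`Measure.AbsolutelyContinuous.map`): `dU.map avg ≪ dV ⇒ dU.map (T ∘ avg) ≪ dV.map T`. [folklore] -/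
theorem absolutelyContinuous_map_comp {ν : Measure β} {μ : Measure α} {avg : β → α} (havg : Measurable avg)
    (hac : ν.map avg ≪ μ) {T : α → γ} (hT : Measurable T) : ν.map (T ∘ avg) ≪ μ.map T := by
  rw [← Measure.map_map hT havg]
  exact hac.map hT

end GenericTraj

section Pullback

open T4LipschitzLedger

variable {ι : Type*} {Ω Ω' : ℕ → ι → Type*} [∀ K τ, MeasurableSpace (Ω K τ)] [∀ K τ, MeasurableSpace (Ω' K τ)]
  {l₀ : ℝ} {T : ℕ → Finset ι} {X : ℕ → ℝ → ι → ℝ} {χ : ℕ → ℝ → ℝ} {κ Lχ : ℕ → ℝ} {N : ℕ} {n : ℕ → ℕ}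
  {m : ℕ → ι → ℕ} {slot : ℕ → ι → ℕ → Σ _ : ℕ, ℕ} {pol : ℕ → ι → ℕ → Pol} {θ : ℕ → ι → ℕ → ℝ}
  {uX uY : (K : ℕ) → (τ : ι) → ℕ → Ω K τ → ℝ} {RX : (K : ℕ) → ℝ → (τ : ι) → Ω K τ → ℝ}

/-- **§5b `TermRepr` PULLS BACK ALONG PUSH-FORWARDS.**  A run's `TermRepr` against push-forward references `(ν K τ).map (F K τ)`
(`F K τ` measurable) IS a `TermRepr` against `ν` with the tested variables and the remainder composed with `F K τ`
(Mathlib `integral_map`, `ae_of_ae_map`, `Integrable.comp_measurable`; the structural fields are untouched). [folklore] -/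
theorem termRepr_pullback (ν : (K : ℕ) → (τ : ι) → Measure (Ω' K τ)) (F : (K : ℕ) → (τ : ι) → Ω' K τ → Ω K τ)
    (hF : ∀ K τ, Measurable (F K τ))
    (h : TermRepr l₀ T X χ κ Lχ N n (fun K τ => (ν K τ).map (F K τ)) m slot pol θ uX uY RX) :
    TermRepr l₀ T X χ κ Lχ N n ν m slot pol θ (fun K τ i w => uX K τ i (F K τ w))
      (fun K τ i w => uY K τ i (F K τ w)) (fun K t τ w => RX K t τ (F K τ w)) where
  profile := h.profile
  thr_pos := h.thr_pos
  slot_mem := h.slot_mem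
  slot_band := h.slot_band
  meas K τ hτ i hi := ⟨(h.meas K τ hτ i hi).1.comp (hF K τ), (h.meas K τ hτ i hi).2.comp (hF K τ)⟩
  rem_nonneg K t ht τ hτ := ae_of_ae_map (hF K τ).aemeasurable (h.rem_nonneg K t ht τ hτ)
  rem_int K t ht τ hτ := (h.rem_int K t ht τ hτ).comp_measurable (hF K τ)
  repr K t ht τ hτ := by
    rw [h.repr K t ht τ hτ]
    exact integral_map (hF K τ).aemeasurable (h.integrable_prod ht hτ).aestronglyMeasurable

end Pullback

section Trajectory

open T4LipschitzLedger T4FiniteEpsInhabited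

variable {ι : Type*} {G : Type*} [GaugeGroup G] [MeasurableSpace G] [HaarData G] [StandardBorelSpace G]
  {Pf : ℕ → ι → Params} {lvl : ℕ → ι → ℕ} {ΩA : ℕ → ι → Type*} [∀ K τ, MeasurableSpace (ΩA K τ)]
  {l₀ : ℝ} {T : ℕ → Finset ι} {B : ℕ → ℝ → ι → ℝ} {χ : ℕ → ℝ → ℝ} {κ Lχ : ℕ → ℝ} {N : ℕ} {n : ℕ → ℕ}
  {m : ℕ → ι → ℕ} {slot : ℕ → ι → ℕ → Σ _ : ℕ, ℕ} {pol : ℕ → ι → ℕ → Pol} {θ : ℕ → ι → ℕ → ℝ}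
  {uB uZ : (K : ℕ) → (τ : ι) → ℕ → ΩA K τ × ΩFine (G := G) Pf lvl K τ → ℝ}
  {RB : (K : ℕ) → ℝ → (τ : ι) → ΩA K τ × ΩFine (G := G) Pf lvl K τ → ℝ}

/-- **§5c THE DISINTEGRATION CONSTRUCTOR IN THE TRAJECTORY PRESENTATION.**  Run A's per-term reference presented on ANY
measurable space `Ω_A K τ` as the image `(dV).map (Tr K τ)` of the finest-common-level product Haar measure under a measurable
map `Tr K τ` (e.g. the deterministic tower of successive averagings), run B's reference the joint law of `(Tr (avg U), U)`
under `dU`: a run-B `TermRepr` against the joint laws is a `TermRepr` against `cpl ((dV).map Tr) (fibOf jointLaw)` with the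
remainder multiplied by the marginal density — `T4TermReprCoupling.termRepr_cpl_of_disintegration`, its demands discharged from
the FINEST step's `HaarAC` alone (`absolutelyContinuous_map_comp`; finiteness of the image of a probability measure and the
standard Borel fibre are inferred automatically). [folklore] -/
theorem termRepr_cpl_of_jointLaw_traj
    (avg : (K : ℕ) → (τ : ι) → ΩFine (G := G) Pf lvl K τ → ΩC (G := G) Pf lvl K τ)
    (havg : ∀ K τ, Measurable (avg K τ)) (hac : ∀ K τ, HaarAC (avg K τ))
    (Tr : (K : ℕ) → (τ : ι) → ΩC (G := G) Pf lvl K τ → ΩA K τ) (hTr : ∀ K τ, Measurable (Tr K τ))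
    (hB : TermRepr l₀ T B χ κ Lχ N n
      (fun K τ => jointLaw (fieldMeasure (Pf K τ) (lvl K τ) G) (Tr K τ ∘ avg K τ)) m slot pol θ uB uZ RB) :
    TermRepr l₀ T B χ κ Lχ N n
      (cpl (fun K τ => (fieldMeasure (Pf K τ) (lvl K τ + 1) G).map (Tr K τ))
        (fibOf fun K τ => jointLaw (fieldMeasure (Pf K τ) (lvl K τ) G) (Tr K τ ∘ avg K τ)))
      m slot pol θ uB uZ
      (fun K t τ z => (hdOf (fun K τ => jointLaw (fieldMeasure (Pf K τ) (lvl K τ) G) (Tr K τ ∘ avg K τ))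
        (fun K τ => (fieldMeasure (Pf K τ) (lvl K τ + 1) G).map (Tr K τ)) K τ z.1 : ℝ) * RB K t τ z) :=
  termRepr_cpl_of_disintegration _
    (fun K τ => by
      rw [jointLaw_fst _ ((hTr K τ).comp (havg K τ))]
      exact absolutelyContinuous_map_comp (havg K τ) (hac K τ) (hTr K τ)) hB

end Trajectory

section Tower2

open T4LipschitzLedger T4FiniteEpsInhabited

variable {ι : Type*} {G : Type*} [GaugeGroup G] [MeasurableSpace G] [HaarData G] [StandardBorelSpace G]
  {Pf : ℕ → ι → Params} {lvl : ℕ → ι → ℕ}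
  {l₀ : ℝ} {T : ℕ → Finset ι} {B : ℕ → ℝ → ι → ℝ} {χ : ℕ → ℝ → ℝ} {κ Lχ : ℕ → ℝ} {N : ℕ} {n : ℕ → ℕ}
  {m : ℕ → ι → ℕ} {slot : ℕ → ι → ℕ → Σ _ : ℕ, ℕ} {pol : ℕ → ι → ℕ → Pol} {θ : ℕ → ι → ℕ → ℝ}
  {uB uZ : (K : ℕ) → (τ : ι) → ℕ →
    (ΩC (G := G) Pf lvl K τ × GaugeField (Pf K τ) (lvl K τ + 1 + 1) G) × ΩFine (G := G) Pf lvl K τ → ℝ}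
  {RB : (K : ℕ) → ℝ → (τ : ι) →
    (ΩC (G := G) Pf lvl K τ × GaugeField (Pf K τ) (lvl K τ + 1 + 1) G) × ΩFine (G := G) Pf lvl K τ → ℝ}

/-- **§5d THE TWO-LEVEL TOWER.**  Run A = two levels `(V, V̄′)` with `V̄′ = avg′ V` a merely MEASURABLE second averaging (no
`HaarAC` asked of it — it is common to both runs), reference `(dV).map (V ↦ (V, avg′ V))`; run B = the extra finest level `U`
below, `V = avg U` with `HaarAC`: the coupled `TermRepr` on `(Ω_C × Ω_{C+1}) × Ω_F`. [folklore] -/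
theorem termRepr_cpl_of_jointLaw_tower2
    (avg : (K : ℕ) → (τ : ι) → ΩFine (G := G) Pf lvl K τ → ΩC (G := G) Pf lvl K τ)
    (havg : ∀ K τ, Measurable (avg K τ)) (hac : ∀ K τ, HaarAC (avg K τ))
    (avg' : (K : ℕ) → (τ : ι) → ΩC (G := G) Pf lvl K τ → GaugeField (Pf K τ) (lvl K τ + 1 + 1) G)
    (havg' : ∀ K τ, Measurable (avg' K τ))
    (hB : TermRepr l₀ T B χ κ Lχ N n
      (fun K τ => jointLaw (fieldMeasure (Pf K τ) (lvl K τ) G) ((fun V => (V, avg' K τ V)) ∘ avg K τ))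
      m slot pol θ uB uZ RB) :
    TermRepr l₀ T B χ κ Lχ N n
      (cpl (fun K τ => (fieldMeasure (Pf K τ) (lvl K τ + 1) G).map (fun V => (V, avg' K τ V)))
        (fibOf fun K τ => jointLaw (fieldMeasure (Pf K τ) (lvl K τ) G) ((fun V => (V, avg' K τ V)) ∘ avg K τ)))
      m slot pol θ uB uZ
      (fun K t τ z => (hdOf (fun K τ => jointLaw (fieldMeasure (Pf K τ) (lvl K τ) G) ((fun V => (V, avg' K τ V)) ∘ avg K τ))
        (fun K τ => (fieldMeasure (Pf K τ) (lvl K τ + 1) G).map (fun V => (V, avg' K τ V))) K τ z.1 : ℝ) * RB K t τ z) :=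
  termRepr_cpl_of_jointLaw_traj avg havg hac (fun K τ V => (V, avg' K τ V))
    (fun K τ => measurable_id.prodMk (havg' K τ)) hB

end Tower2

section Tower2SUN

open T4LipschitzLedger T4FiniteEpsInhabited BlockAveraging ExpMeanLog BlockAveragingEMLFibreLawSUN

variable {ι : Type*} {N : ℕ} [NeZero N] {Pf : ℕ → ι → Params} {lvl : ℕ → ι → ℕ}
  {l₀ : ℝ} {T : ℕ → Finset ι} {B : ℕ → ℝ → ι → ℝ} {χ : ℕ → ℝ → ℝ} {κ Lχ : ℕ → ℝ} {N₀ : ℕ} {n : ℕ → ℕ}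
  {m : ℕ → ι → ℕ} {slot : ℕ → ι → ℕ → Σ _ : ℕ, ℕ} {pol : ℕ → ι → ℕ → Pol} {θ : ℕ → ι → ℕ → ℝ}
  {uB uZ : (K : ℕ) → (τ : ι) → ℕ →
    (ΩC (G := SU N) Pf lvl K τ × GaugeField (Pf K τ) (lvl K τ + 1 + 1) (SU N)) × ΩFine (G := SU N) Pf lvl K τ → ℝ}
  {RB : (K : ℕ) → ℝ → (τ : ι) →
    (ΩC (G := SU N) Pf lvl K τ × GaugeField (Pf K τ) (lvl K τ + 1 + 1) (SU N)) × ΩFine (G := SU N) Pf lvl K τ → ℝ}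

/-- **§5e THE TWO-LEVEL TOWER ON `SU(N)`** with Bałaban's exp-mean-log block averaging at BOTH steps: unconditional in the
standing range of the FINEST step (`hr`); the second step enters through its measurability only. [folklore] -/
theorem termRepr_cpl_of_blockAvg_SUN_tower2 (hr : ∀ K τ, lvl K τ + 1 ≤ (Pf K τ).m + (Pf K τ).K)
    (hB : TermRepr l₀ T B χ κ Lχ N₀ n
      (fun K τ => jointLaw (fieldMeasure (Pf K τ) (lvl K τ) (SU N))
        ((fun V : ΩC (G := SU N) Pf lvl K τ =>
            (V, (avgFun (expMeanLogSU : LoopAverage (SU N)) V : GaugeField (Pf K τ) (lvl K τ + 1 + 1) (SU N)))) ∘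
          (avgFun (expMeanLogSU : LoopAverage (SU N)) : ΩFine (G := SU N) Pf lvl K τ → ΩC (G := SU N) Pf lvl K τ)))
      m slot pol θ uB uZ RB) :
    TermRepr l₀ T B χ κ Lχ N₀ n
      (cpl (fun K τ => (fieldMeasure (Pf K τ) (lvl K τ + 1) (SU N)).map (fun V : ΩC (G := SU N) Pf lvl K τ =>
          (V, (avgFun (expMeanLogSU : LoopAverage (SU N)) V : GaugeField (Pf K τ) (lvl K τ + 1 + 1) (SU N)))))
        (fibOf fun K τ => jointLaw (fieldMeasure (Pf K τ) (lvl K τ) (SU N))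
          ((fun V : ΩC (G := SU N) Pf lvl K τ =>
              (V, (avgFun (expMeanLogSU : LoopAverage (SU N)) V : GaugeField (Pf K τ) (lvl K τ + 1 + 1) (SU N)))) ∘
            (avgFun (expMeanLogSU : LoopAverage (SU N)) : ΩFine (G := SU N) Pf lvl K τ → ΩC (G := SU N) Pf lvl K τ))))
      m slot pol θ uB uZ
      (fun K t τ z => (hdOf (fun K τ => jointLaw (fieldMeasure (Pf K τ) (lvl K τ) (SU N))
          ((fun V : ΩC (G := SU N) Pf lvl K τ =>
              (V, (avgFun (expMeanLogSU : LoopAverage (SU N)) V : GaugeField (Pf K τ) (lvl K τ + 1 + 1) (SU N)))) ∘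
            (avgFun (expMeanLogSU : LoopAverage (SU N)) : ΩFine (G := SU N) Pf lvl K τ → ΩC (G := SU N) Pf lvl K τ)))
        (fun K τ => (fieldMeasure (Pf K τ) (lvl K τ + 1) (SU N)).map (fun V : ΩC (G := SU N) Pf lvl K τ =>
          (V, (avgFun (expMeanLogSU : LoopAverage (SU N)) V : GaugeField (Pf K τ) (lvl K τ + 1 + 1) (SU N))))) K τ z.1 : ℝ) *
        RB K t τ z) :=
  termRepr_cpl_of_jointLaw_tower2 _ (fun _ _ => measurable_avgFun _ measurable_expMeanLogSU_E)
    (fun K τ => haarAC_avgFun_expMeanLogSU_SUN (hr K τ)) _ (fun _ _ => measurable_avgFun _ measurable_expMeanLogSU_E) hB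

end Tower2SUN

/-! ## §6 (v1.2) THE WINDOW PRESENTATION: performed integrations as VALUES — both runs on ONE `K`-independent space

DESIGN (W) (record `t4/T4-EST-U5bE2.md` §17; the cell's U5 referee's reading F6 (c) of `t4/T4-REF-U5.md` §11, ruling
request R-Ω-1, ANSWERED by the pv07 lineage in `CLAIMS.log` 2026-08-19): the space on which the ledger's pointwise remainder
sandwich `hsw` of `T4LipschitzLedger.cauchy_of_repr` is asserted is NOT a run's finest (bare) field — there the two runs'
remainders are a bare density against a once-integrated one and no per-cell smallness is available — but the WINDOW: the
gauge field at the OLDEST YOUNG level of the term (plus whatever young auxiliary variables the term's operations carry — the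
node-U5d/U0 typing, owed item (o1), untouched here), a finite lattice that is THE SAME for both runs and does not depend on
the cutoff `K`; every OLDER integration — run A's `K − N_W` finest steps, run B's `K + 1 − N_W` (its extra level is the OLDEST,
hence among them) — is PERFORMED and enters the remainder as a VALUE: the Radon–Nikodym density, with respect to the window's
product Haar measure, of the image of the weighted finest-level measure under the old tower map.  On that space both runs'
references COINCIDE (`μ_A = μ_B`, no fibre, no marginal density), so `cauchy_of_repr` applies with no coupling file in
between, and `hsw` compares the two PERFORMED old densities — the cell's node-U5b two-run factor ledger, a BINDER as before.

What this section supplies, all [folklore]: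
* §6a (GENERIC) `perfDensity ν F Tr μ : α → ℝ≥0` — the performed density (`T4TermReprCoupling.rnNN` of the image under `Tr` of
  `F⁺ · ν` with respect to `μ`); finiteness and absolute continuity of that image (`ν.map Tr ≪ μ` suffices); `withDensity_perfDensity`;
  THE PUSH-FORWARD IDENTITY `∫ g · perfDensity dμ = ∫ (g ∘ Tr) · F dν` for measurable `g` and integrable a.e.-nonnegative `F`
  (`integral_perfDensity_mul`; Mathlib `integral_withDensity_eq_integral_smul`, `integral_map`,
  `integral_withDensity_eq_integral_toReal_smul₀`); integrability (`integrable_perfDensity`).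
* §6b **`termRepr_performed`** — the converse companion of §5b `termRepr_pullback`: a `T4LipschitzLedger.TermRepr` against
  references `ν K τ` on a run's FINEST space whose tested variables factor through measurable maps `Tr K τ` into spaces `Ω K τ`
  carrying σ-finite references `μ K τ` with `(ν K τ).map (Tr K τ) ≪ μ K τ` IS a `TermRepr` against `μ K τ` with the same tested
  variables (asked measurable on `Ω K τ`) and remainder `perfDensity (ν K τ) (R K t τ) (Tr K τ) (μ K τ)`.  Two runs so presented
  with the same `(Ω K τ, μ K τ)` feed `cauchy_of_repr` directly.
* §6c (GAUGE FIELDS) the exact `k`-step tower map `towerMap avg lvl k : GaugeField P lvl G → GaugeField P (lvl + k) G` of a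
  level-indexed family of one-step averagings, its measurability, and **`towerAC`**: one-step `T4FiniteEpsInhabited.HaarAC` at
  each of the `k` levels ⇒ `(fieldMeasure P lvl G).map (towerMap avg lvl k) ≪ fieldMeasure P (lvl + k) G` (Mathlib
  `Measure.AbsolutelyContinuous.map`, iterated); the relabelling step `absolutelyContinuous_map_comp_of_map` (a.c. carried along a
  further measurable map whose image measure is dominated — the identification of run A's level `K − N_W`, run B's level
  `K + 1 − N_W` and the window lattice is such a relabelling of bonds, owed item (o6), not constructed here); the `SU(N)`
  exp-mean-log instance `towerAC_expMeanLogSU_SUN`, unconditional in the standing range `lvl + k ≤ m + K`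
  (`BlockAveragingEMLFibreLawSUN.haarAC_avgFun_expMeanLogSU_SUN` by name); and the assembled constructors `termRepr_window` /
  `termRepr_window_SUN` (finest reference = product Haar, `Tr` = relabelling ∘ tower map).
* §6d SANITY: `termRepr_performed` fires on the ledger's toy (`Tr = id`).
NOT an estimate; nothing of [Balaban1988RG2] / [Balaban1989LargeFieldII] is constructed or asserted; the identification of a
printed term's young variables, undeclared young factors and old weight `F` is the node-U5d/U0 typing (owed item (o1)). -/

section Performed

variable {α β γ : Type*} [MeasurableSpace α] [MeasurableSpace β] [MeasurableSpace γ]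

/-- **§6a THE PERFORMED DENSITY.**  For a reference `ν` on the fine space, a weight `F` and a map `Tr` into the window space with
reference `μ`: the `ℝ≥0`-valued Radon–Nikodym density with respect to `μ` of the image under `Tr` of the weighted measure
`F⁺ · ν` — the integration over the fibres of `Tr`, PERFORMED, as a value on the window space. [folklore] -/
def perfDensity (ν : Measure β) (F : β → ℝ) (Tr : β → α) (μ : Measure α) : α → ℝ≥0 :=
  rnNN ((ν.withDensity fun w => ENNReal.ofReal (F w)).map Tr) μ

/-- The performed density is measurable. [folklore] -/
theorem measurable_perfDensity (ν : Measure β) (F : β → ℝ) (Tr : β → α) (μ : Measure α) :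
    Measurable (perfDensity ν F Tr μ) :=
  measurable_rnNN _ _

/-- The image of the weighted measure is finite for an integrable weight. [folklore] -/
theorem isFiniteMeasure_map_withDensity {ν : Measure β} {F : β → ℝ} (hF : Integrable F ν) (Tr : β → α) :
    IsFiniteMeasure ((ν.withDensity fun w => ENNReal.ofReal (F w)).map Tr) :=
  haveI := isFiniteMeasure_withDensity_ofReal hF.2
  inferInstance

/-- The image of the weighted measure is absolutely continuous with respect to `μ` as soon as `ν.map Tr ≪ μ`. [folklore] -/
theorem map_withDensity_absolutelyContinuous {ν : Measure β} (F : β → ℝ) {Tr : β → α} (hTr : Measurable Tr)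
    {μ : Measure α} (hac : ν.map Tr ≪ μ) : (ν.withDensity fun w => ENNReal.ofReal (F w)).map Tr ≪ μ :=
  ((withDensity_absolutelyContinuous ν _).map hTr).trans hac

/-- `μ` with the performed density IS the image of the weighted measure. [folklore] -/
theorem withDensity_perfDensity {ν : Measure β} {F : β → ℝ} (hF : Integrable F ν) {Tr : β → α} (hTr : Measurable Tr)
    {μ : Measure α} [SigmaFinite μ] (hac : ν.map Tr ≪ μ) :
    μ.withDensity (fun a => (perfDensity ν F Tr μ a : ℝ≥0∞)) = (ν.withDensity fun w => ENNReal.ofReal (F w)).map Tr :=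
  haveI := isFiniteMeasure_map_withDensity hF Tr
  withDensity_rnNN_eq _ μ (map_withDensity_absolutelyContinuous F hTr hac)

/-- **THE PUSH-FORWARD IDENTITY of the performed density**: `∫ g · perfDensity dμ = ∫ (g ∘ Tr) · F dν` for measurable `g` and an
integrable almost everywhere nonnegative weight `F`. [folklore] -/
theorem integral_perfDensity_mul {ν : Measure β} {F : β → ℝ} (hF : Integrable F ν) (hF0 : 0 ≤ᵐ[ν] F) {Tr : β → α}
    (hTr : Measurable Tr) {μ : Measure α} [SigmaFinite μ] (hac : ν.map Tr ≪ μ) {g : α → ℝ} (hg : Measurable g) :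
    ∫ a, g a * (perfDensity ν F Tr μ a : ℝ) ∂μ = ∫ w, g (Tr w) * F w ∂ν := by
  have h1 : ∫ a, g a * (perfDensity ν F Tr μ a : ℝ) ∂μ =
      ∫ a, g a ∂(μ.withDensity fun a => (perfDensity ν F Tr μ a : ℝ≥0∞)) := by
    rw [integral_withDensity_eq_integral_smul (measurable_perfDensity ν F Tr μ)]
    refine integral_congr_ae (ae_of_all _ fun a => ?_)
    simp only [NNReal.smul_def, smul_eq_mul]
    ring
  rw [h1, withDensity_perfDensity hF hTr hac, integral_map hTr.aemeasurable hg.aestronglyMeasurable,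
    integral_withDensity_eq_integral_toReal_smul₀ hF.1.aemeasurable.ennreal_ofReal
      (ae_of_all _ fun _ => ENNReal.ofReal_lt_top)]
  refine integral_congr_ae ?_
  filter_upwards [hF0] with w hw
  have hw' : 0 ≤ F w := hw
  rw [smul_eq_mul, ENNReal.toReal_ofReal hw', mul_comm]

/-- The performed density of an integrable weight is integrable. [folklore] -/
theorem integrable_perfDensity {ν : Measure β} {F : β → ℝ} (hF : Integrable F ν) {Tr : β → α} (hTr : Measurable Tr)
    {μ : Measure α} [SigmaFinite μ] (hac : ν.map Tr ≪ μ) : Integrable (fun a => (perfDensity ν F Tr μ a : ℝ)) μ := by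
  haveI := isFiniteMeasure_map_withDensity hF Tr
  have hlt : ∫⁻ a, (perfDensity ν F Tr μ a : ℝ≥0∞) ∂μ ≠ ∞ := by
    rw [← setLIntegral_univ, ← withDensity_apply _ MeasurableSet.univ, withDensity_perfDensity hF hTr hac]
    exact measure_ne_top _ _
  have h := integrable_toReal_of_lintegral_ne_top
    (measurable_perfDensity ν F Tr μ).coe_nnreal_ennreal.aemeasurable hlt
  simpa only [ENNReal.coe_toReal] using h

/-- Absolute continuity carried one measurable map further when the image of the dominating measure is itself dominated —
the RELABELLING step (e.g. the identification of two runs' equal lattices). [folklore] -/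
theorem absolutelyContinuous_map_comp_of_map {ν : Measure β} {μ₁ : Measure α} {μ₂ : Measure γ} {Tr : β → α}
    (hTr : Measurable Tr) (h₁ : ν.map Tr ≪ μ₁) {e : α → γ} (he : Measurable e) (h₂ : μ₁.map e ≪ μ₂) :
    ν.map (e ∘ Tr) ≪ μ₂ := by
  rw [← Measure.map_map he hTr]
  exact (h₁.map he).trans h₂

end Performed

section PerformedRepr

open T4LipschitzLedger

variable {ι : Type*} {Ω Ωf : ℕ → ι → Type*} [∀ K τ, MeasurableSpace (Ω K τ)] [∀ K τ, MeasurableSpace (Ωf K τ)]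
  {l₀ : ℝ} {T : ℕ → Finset ι} {X : ℕ → ℝ → ι → ℝ} {χ : ℕ → ℝ → ℝ} {κ Lχ : ℕ → ℝ} {N : ℕ} {n : ℕ → ℕ}
  {m : ℕ → ι → ℕ} {slot : ℕ → ι → ℕ → Σ _ : ℕ, ℕ} {pol : ℕ → ι → ℕ → Pol} {θ : ℕ → ι → ℕ → ℝ}
  {uX uY : (K : ℕ) → (τ : ι) → ℕ → Ω K τ → ℝ} {F : (K : ℕ) → ℝ → (τ : ι) → Ωf K τ → ℝ}

/-- **§6b PERFORMED INTEGRATIONS AS VALUES.**  A run's `TermRepr` against references `ν K τ` on its finest spaces, whose tested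
variables factor through measurable maps `Tr K τ` into spaces `Ω K τ` with σ-finite references `μ K τ` dominating the images
`(ν K τ).map (Tr K τ)`, IS a `TermRepr` against `μ K τ` with the same tested variables (measurable on `Ω K τ`) and the PERFORMED
remainder `perfDensity (ν K τ) (F K t τ) (Tr K τ) (μ K τ)`.  The structural fields are untouched. [folklore] -/
theorem termRepr_performed (ν : (K : ℕ) → (τ : ι) → Measure (Ωf K τ)) (μ : (K : ℕ) → (τ : ι) → Measure (Ω K τ))
    [∀ K τ, SigmaFinite (μ K τ)] (Tr : (K : ℕ) → (τ : ι) → Ωf K τ → Ω K τ) (hTr : ∀ K τ, Measurable (Tr K τ))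
    (hac : ∀ K τ, (ν K τ).map (Tr K τ) ≪ μ K τ)
    (hmeas : ∀ K, ∀ τ ∈ T K, ∀ i < m K τ, Measurable (uX K τ i) ∧ Measurable (uY K τ i))
    (h : TermRepr l₀ T X χ κ Lχ N n ν m slot pol θ (fun K τ i w => uX K τ i (Tr K τ w))
      (fun K τ i w => uY K τ i (Tr K τ w)) F) :
    TermRepr l₀ T X χ κ Lχ N n μ m slot pol θ uX uY
      (fun K t τ a => (perfDensity (ν K τ) (F K t τ) (Tr K τ) (μ K τ) a : ℝ)) where
  profile := h.profile
  thr_pos := h.thr_pos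
  slot_mem := h.slot_mem
  slot_band := h.slot_band
  meas := hmeas
  rem_nonneg K t ht τ hτ := ae_of_all _ fun a => NNReal.coe_nonneg _
  rem_int K t ht τ hτ := integrable_perfDensity (h.rem_int K t ht τ hτ) (hTr K τ) (hac K τ)
  repr K t ht τ hτ := by
    rw [h.repr K t ht τ hτ]
    exact (integral_perfDensity_mul (h.rem_int K t ht τ hτ) (h.rem_nonneg K t ht τ hτ) (hTr K τ) (hac K τ)
      (Finset.measurable_prod _ fun i hi =>
        measurable_facAt h.profile (hmeas K τ hτ i (Finset.mem_range.1 hi)).1)).symm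

end PerformedRepr

section Tower

open T4FiniteEpsInhabited

variable {P : Params} {G : Type*}

/-- **§6c THE EXACT `k`-STEP TOWER MAP** of a level-indexed family of one-step averagings: `U ↦ avg_{lvl+k-1} (⋯ (avg_{lvl} U))`,
`GaugeField P lvl G → GaugeField P (lvl + k) G`. [folklore] -/
def towerMap (avg : (j : ℕ) → GaugeField P j G → GaugeField P (j+1) G) (lvl : ℕ) :
    (k : ℕ) → GaugeField P lvl G → GaugeField P (lvl + k) G
  | 0 => id
  | k + 1 => fun U => avg (lvl + k) (towerMap avg lvl k U)

/-- zero steps: the identity. [folklore] -/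
@[simp] theorem towerMap_zero (avg : (j : ℕ) → GaugeField P j G → GaugeField P (j+1) G) (lvl : ℕ) :
    towerMap avg lvl 0 = id := rfl

/-- one more step: average once more. [folklore] -/
@[simp] theorem towerMap_succ (avg : (j : ℕ) → GaugeField P j G → GaugeField P (j+1) G) (lvl k : ℕ)
    (U : GaugeField P lvl G) : towerMap avg lvl (k + 1) U = avg (lvl + k) (towerMap avg lvl k U) := rfl

variable [MeasurableSpace G]

/-- The tower map is measurable when every step is. [folklore] -/
theorem measurable_towerMap (avg : (j : ℕ) → GaugeField P j G → GaugeField P (j+1) G) (havg : ∀ j, Measurable (avg j))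
    (lvl : ℕ) : ∀ k, Measurable (towerMap avg lvl k)
  | 0 => measurable_id
  | k + 1 => by
    show Measurable fun U => avg (lvl + k) (towerMap avg lvl k U)
    exact (havg (lvl + k)).comp (measurable_towerMap avg havg lvl k)

variable [GaugeGroup G] [HaarData G]

/-- **ITERATED `HaarAC`.**  One-step `HaarAC` at each of the `k` levels `lvl, …, lvl + k − 1` ⇒ the image of product Haar measure at
level `lvl` under the `k`-step tower map is absolutely continuous with respect to product Haar measure at level `lvl + k`. [folklore] -/
theorem towerAC (avg : (j : ℕ) → GaugeField P j G → GaugeField P (j+1) G) (havg : ∀ j, Measurable (avg j)) (lvl : ℕ) :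
    ∀ k, (∀ i < k, HaarAC (avg (lvl + i))) →
      (fieldMeasure P lvl G).map (towerMap avg lvl k) ≪ fieldMeasure P (lvl + k) G
  | 0, _ => by
    show (fieldMeasure P lvl G).map id ≪ fieldMeasure P lvl G
    rw [Measure.map_id]
  | k + 1, h => by
    have ih := towerAC avg havg lvl k fun i hi => h i (Nat.lt_succ_of_lt hi)
    have hk : HaarAC (avg (lvl + k)) := h k (Nat.lt_succ_self k)
    rw [show towerMap avg lvl (k + 1) = avg (lvl + k) ∘ towerMap avg lvl k from rfl,
      ← Measure.map_map (havg (lvl + k)) (measurable_towerMap avg havg lvl k)]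
    exact (ih.map (havg (lvl + k))).trans hk

end Tower

section TowerSUN

open T4FiniteEpsInhabited BlockAveraging ExpMeanLog BlockAveragingEMLFibreLawSUN

variable {N : ℕ} [NeZero N] {P : Params}

/-- **ITERATED `HaarAC` ON `SU(N)` with Bałaban's exp-mean-log block averaging (0.4) at every step**, unconditional in the
standing range `lvl + k ≤ m + K`. [folklore] -/
theorem towerAC_expMeanLogSU_SUN (lvl k : ℕ) (h : lvl + k ≤ P.m + P.K) :
    (fieldMeasure P lvl (SU N)).map
        (towerMap (fun j => (avgFun (expMeanLogSU : LoopAverage (SU N)) :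
          GaugeField P j (SU N) → GaugeField P (j+1) (SU N))) lvl k) ≪ fieldMeasure P (lvl + k) (SU N) :=
  towerAC _ (fun _ => measurable_avgFun _ measurable_expMeanLogSU_E) lvl k
    fun i hi => haarAC_avgFun_expMeanLogSU_SUN (by omega)

end TowerSUN

section Window

open T4LipschitzLedger T4FiniteEpsInhabited

variable {ι : Type*} {G : Type*} [GaugeGroup G] [MeasurableSpace G] [HaarData G]
  {Ω : ℕ → ι → Type*} [∀ K τ, MeasurableSpace (Ω K τ)]
  {l₀ : ℝ} {T : ℕ → Finset ι} {X : ℕ → ℝ → ι → ℝ} {χ : ℕ → ℝ → ℝ} {κ Lχ : ℕ → ℝ} {N₀ : ℕ} {n : ℕ → ℕ}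
  {m : ℕ → ι → ℕ} {slot : ℕ → ι → ℕ → Σ _ : ℕ, ℕ} {pol : ℕ → ι → ℕ → Pol} {θ : ℕ → ι → ℕ → ℝ}
  {uX uY : (K : ℕ) → (τ : ι) → ℕ → Ω K τ → ℝ}

/-- **THE WINDOW PRESENTATION OF ONE RUN** (design (W)).  Per term: the run's parameters `Pf K τ`, its finest level `lvl K τ`, the
number `k K τ` of OLD steps, a level-indexed family of measurable one-step averagings with `HaarAC` along the old chain, a
measurable RELABELLING `e K τ` of the fields at level `lvl K τ + k K τ` onto the window space `Ω K τ` whose image of product Haar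
measure is dominated by the window reference `μ K τ` (σ-finite), tested variables measurable on the window and, on the finest
space, factoring through `e K τ ∘ towerMap`, and a `TermRepr` against product Haar measure on the finest level with weight `F`
⇒ a `TermRepr` against `μ K τ` on the window with the PERFORMED remainder.  Two runs presented on the same `(Ω K τ, μ K τ)` feed
`T4LipschitzLedger.cauchy_of_repr` directly. [folklore] -/
theorem termRepr_window (Pf : ℕ → ι → Params) (lvl k : ℕ → ι → ℕ)
    (avg : (K : ℕ) → (τ : ι) → (j : ℕ) → GaugeField (Pf K τ) j G → GaugeField (Pf K τ) (j+1) G)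
    (havg : ∀ K τ j, Measurable (avg K τ j)) (hac : ∀ K τ, ∀ i < k K τ, HaarAC (avg K τ (lvl K τ + i)))
    (μ : (K : ℕ) → (τ : ι) → Measure (Ω K τ)) [∀ K τ, SigmaFinite (μ K τ)]
    (e : (K : ℕ) → (τ : ι) → GaugeField (Pf K τ) (lvl K τ + k K τ) G → Ω K τ) (he : ∀ K τ, Measurable (e K τ))
    (heμ : ∀ K τ, (fieldMeasure (Pf K τ) (lvl K τ + k K τ) G).map (e K τ) ≪ μ K τ)
    (hmeas : ∀ K, ∀ τ ∈ T K, ∀ i < m K τ, Measurable (uX K τ i) ∧ Measurable (uY K τ i))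
    {F : (K : ℕ) → ℝ → (τ : ι) → GaugeField (Pf K τ) (lvl K τ) G → ℝ}
    (h : TermRepr l₀ T X χ κ Lχ N₀ n (fun K τ => fieldMeasure (Pf K τ) (lvl K τ) G) m slot pol θ
      (fun K τ i w => uX K τ i (e K τ (towerMap (avg K τ) (lvl K τ) (k K τ) w)))
      (fun K τ i w => uY K τ i (e K τ (towerMap (avg K τ) (lvl K τ) (k K τ) w))) F) :
    TermRepr l₀ T X χ κ Lχ N₀ n μ m slot pol θ uX uY
      (fun K t τ a => (perfDensity (fieldMeasure (Pf K τ) (lvl K τ) G) (F K t τ)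
        (e K τ ∘ towerMap (avg K τ) (lvl K τ) (k K τ)) (μ K τ) a : ℝ)) :=
  termRepr_performed _ μ (fun K τ => e K τ ∘ towerMap (avg K τ) (lvl K τ) (k K τ))
    (fun K τ => (he K τ).comp (measurable_towerMap (avg K τ) (havg K τ) (lvl K τ) (k K τ)))
    (fun K τ => absolutelyContinuous_map_comp_of_map (measurable_towerMap (avg K τ) (havg K τ) (lvl K τ) (k K τ))
      (towerAC (avg K τ) (havg K τ) (lvl K τ) (k K τ) (hac K τ)) (he K τ) (heμ K τ))
    hmeas h

end Window

section WindowSUN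

open T4LipschitzLedger T4FiniteEpsInhabited BlockAveraging ExpMeanLog BlockAveragingEMLFibreLawSUN

variable {ι : Type*} {N : ℕ} [NeZero N] {Ω : ℕ → ι → Type*} [∀ K τ, MeasurableSpace (Ω K τ)]
  {l₀ : ℝ} {T : ℕ → Finset ι} {X : ℕ → ℝ → ι → ℝ} {χ : ℕ → ℝ → ℝ} {κ Lχ : ℕ → ℝ} {N₀ : ℕ} {n : ℕ → ℕ}
  {m : ℕ → ι → ℕ} {slot : ℕ → ι → ℕ → Σ _ : ℕ, ℕ} {pol : ℕ → ι → ℕ → Pol} {θ : ℕ → ι → ℕ → ℝ}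
  {uX uY : (K : ℕ) → (τ : ι) → ℕ → Ω K τ → ℝ}

/-- **THE WINDOW PRESENTATION ON `SU(N)` with Bałaban's exp-mean-log block averaging at every old step**: as `termRepr_window`,
the `HaarAC` demands along the old chain DISCHARGED in the standing range `lvl K τ + k K τ ≤ m + K`
(`towerAC_expMeanLogSU_SUN`); left to the instantiating seat: the relabelling `e K τ` with its domination, the measurability of
the window variables, and the finest-level `TermRepr` itself (node-U5d/U0 typing). [folklore] -/
theorem termRepr_window_SUN (Pf : ℕ → ι → Params) (lvl k : ℕ → ι → ℕ)
    (hr : ∀ K τ, lvl K τ + k K τ ≤ (Pf K τ).m + (Pf K τ).K)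
    (μ : (K : ℕ) → (τ : ι) → Measure (Ω K τ)) [∀ K τ, SigmaFinite (μ K τ)]
    (e : (K : ℕ) → (τ : ι) → GaugeField (Pf K τ) (lvl K τ + k K τ) (SU N) → Ω K τ) (he : ∀ K τ, Measurable (e K τ))
    (heμ : ∀ K τ, (fieldMeasure (Pf K τ) (lvl K τ + k K τ) (SU N)).map (e K τ) ≪ μ K τ)
    (hmeas : ∀ K, ∀ τ ∈ T K, ∀ i < m K τ, Measurable (uX K τ i) ∧ Measurable (uY K τ i))
    {F : (K : ℕ) → ℝ → (τ : ι) → GaugeField (Pf K τ) (lvl K τ) (SU N) → ℝ}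
    (h : TermRepr l₀ T X χ κ Lχ N₀ n (fun K τ => fieldMeasure (Pf K τ) (lvl K τ) (SU N)) m slot pol θ
      (fun K τ i w => uX K τ i (e K τ (towerMap (fun j => (avgFun (expMeanLogSU : LoopAverage (SU N)) :
        GaugeField (Pf K τ) j (SU N) → GaugeField (Pf K τ) (j+1) (SU N))) (lvl K τ) (k K τ) w)))
      (fun K τ i w => uY K τ i (e K τ (towerMap (fun j => (avgFun (expMeanLogSU : LoopAverage (SU N)) :
        GaugeField (Pf K τ) j (SU N) → GaugeField (Pf K τ) (j+1) (SU N))) (lvl K τ) (k K τ) w))) F) :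
    TermRepr l₀ T X χ κ Lχ N₀ n μ m slot pol θ uX uY
      (fun K t τ a => (perfDensity (fieldMeasure (Pf K τ) (lvl K τ) (SU N)) (F K t τ)
        (e K τ ∘ towerMap (fun j => (avgFun (expMeanLogSU : LoopAverage (SU N)) :
          GaugeField (Pf K τ) j (SU N) → GaugeField (Pf K τ) (j+1) (SU N))) (lvl K τ) (k K τ)) (μ K τ) a : ℝ)) :=
  termRepr_window Pf lvl k
    (fun K τ j => (avgFun (expMeanLogSU : LoopAverage (SU N)) : GaugeField (Pf K τ) j (SU N) → GaugeField (Pf K τ) (j+1) (SU N)))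
    (fun _ _ _ => measurable_avgFun _ measurable_expMeanLogSU_E)
    (fun K τ i hi => haarAC_avgFun_expMeanLogSU_SUN (by have := hr K τ; omega)) μ e he heμ hmeas h

end WindowSUN

/-! ## §6d SANITY: the window constructor fires -/

namespace Sanity

open T4LipschitzLedger in
/-- `termRepr_performed` FIRES on the ledger's toy of `T4LipschitzLedger` §5 (finest space = window = a point, `Tr = id`, the
Dirac reference dominating its own image). [folklore] -/
theorem termRepr_A_performed :
    TermRepr 1 T4LipschitzLedger.Sanity.T T4LipschitzLedger.Sanity.A T4LipschitzLedger.Sanity.χ T4LipschitzLedger.Sanity.κ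
      T4LipschitzLedger.Sanity.Lχ 0 T4LipschitzLedger.Sanity.n T4LipschitzLedger.Sanity.μ T4LipschitzLedger.Sanity.m
      T4LipschitzLedger.Sanity.slot T4LipschitzLedger.Sanity.pol T4LipschitzLedger.Sanity.θ T4LipschitzLedger.Sanity.uA
      T4LipschitzLedger.Sanity.uB
      (fun K t τ a => (perfDensity (T4LipschitzLedger.Sanity.μ K τ) (T4LipschitzLedger.Sanity.R K t τ) id
        (T4LipschitzLedger.Sanity.μ K τ) a : ℝ)) :=
  termRepr_performed T4LipschitzLedger.Sanity.μ T4LipschitzLedger.Sanity.μ (fun _ _ => id) (fun _ _ => measurable_id)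
    (fun K τ => by rw [Measure.map_id]) (fun _ _ _ _ _ => ⟨measurable_const, measurable_const⟩)
    T4LipschitzLedger.Sanity.termRepr_A

end Sanity

/-! ## §7 (v1.3) THE RELABELLING (owed item (o6)): product Haar ↦ product Haar EXACTLY; the geometric bond equivalence; `heμ` discharged

Design (W) (§6) types both runs on ONE window space and asks, per run, for a measurable RELABELLING `e K τ` of the gauge fields at
the oldest young level onto the window with `heμ : (product Haar).map (e K τ) ≪ μ K τ`.  This section discharges that pair for the
relabellings that occur: `relabel ε U := U ∘ ε` along ANY equivalence `ε` of bond index types is measurable (`measurable_relabel`) and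
carries product Haar measure to product Haar measure EXACTLY (`map_relabel_fieldMeasure`, Mathlib `measurePreserving_piCongrLeft`),
so `heμ` holds with equality (`relabel_haarAC`).  The canonical GEOMETRIC equivalence between two levels with the same dimension and
the same number of sites per direction is `bondEquiv` (sites coordinatewise by `ZMod.ringEquivCongr`, directions by `Fin.cast`); it
is a torus isomorphism (`siteEquiv_shift`, `bondEquiv_tgt`: it commutes with the lattice shifts, hence maps bonds to bonds with the
right endpoints).  The window record of design (W) is `window P N_W := ⟨d, L, m, K := N_W⟩` (same `d`, `L`, `m`; it does not mention
`P.K`), and `sitesPerDir_window` is the numerology «run X's level `K − N_W + j'` and the window's level `j'` have `2·L^{m+N_W−j'}`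
sites per direction» (`N_W ≤ K`), whence `windowBondEquiv`.  Assembled: `termRepr_window_relabel` / `termRepr_window_SUN_relabel` —
§6's window constructors with `e K τ := relabel (ε K τ)` and NO `he` / `heμ` hypotheses left; on `SU(N)` with exp-mean-log averaging
the only remaining inputs are the standing range, the measurability of the window variables and the finest-level `TermRepr` (owed
item (o1)).  HONEST SCOPE: what (o6) still owes after this section is BOOKKEEPING only — that a printed term's young slot variables,
written on the window lattice, are the relabelled further averages of run X (compatibility of the block maps `Setup.blockOf`/`emb`
with `siteEquiv`, which preserves `ZMod.val` by `ZMod.ringEquivCongr_val`; left to the seat typing the slot variables).  Nothing of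
Bałaban's is asserted; no estimate. -/

section Relabel

variable {P P' : Params} {j j' : ℕ} {G : Type*}

/-- **Relabelling** of bond variables along an equivalence of bond index types: `(relabel ε U) b' = U (ε b')`. [folklore] -/
def relabel (ε : PBond P' j' ≃ PBond P j) : GaugeField P j G → GaugeField P' j' G := fun U b' => U (ε b')

/-- Pointwise formula. [folklore] -/
@[simp] theorem relabel_apply (ε : PBond P' j' ≃ PBond P j) (U : GaugeField P j G) (b' : PBond P' j') :
    relabel ε U b' = U (ε b') := rfl

/-- Relabelling along the identity is the identity. [folklore] -/
theorem relabel_refl : relabel (G := G) (Equiv.refl (PBond P j)) = id := rfl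

variable [MeasurableSpace G]

/-- A relabelling is measurable (product σ-algebras). [folklore] -/
theorem measurable_relabel (ε : PBond P' j' ≃ PBond P j) : Measurable (relabel (G := G) ε) :=
  measurable_pi_lambda _ fun b' => measurable_pi_apply (ε b')

variable [GaugeGroup G] [HaarData G]

/-- **A relabelling carries product Haar measure to product Haar measure, exactly.** [folklore] -/
theorem map_relabel_fieldMeasure (ε : PBond P' j' ≃ PBond P j) :
    (fieldMeasure P j G).map (relabel ε) = fieldMeasure P' j' G := by
  have h := measurePreserving_piCongrLeft (fun _ : PBond P' j' => (HaarData.haar : Measure G)) ε.symm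
  have he : (⇑(MeasurableEquiv.piCongrLeft (fun _ : PBond P' j' => G) ε.symm) :
      GaugeField P j G → GaugeField P' j' G) = relabel ε := by
    funext U b'
    simp only [MeasurableEquiv.coe_piCongrLeft, Equiv.piCongrLeft_apply_eq_cast, cast_eq, Equiv.symm_symm,
      relabel_apply]
  rw [← he]
  exact h.map_eq

/-- Hence the domination hypothesis `heμ` of `termRepr_window` holds for `e := relabel ε`, `μ :=` product Haar. [folklore] -/
theorem relabel_haarAC (ε : PBond P' j' ≃ PBond P j) :
    (fieldMeasure P j G).map (relabel ε) ≪ fieldMeasure P' j' G := by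
  rw [map_relabel_fieldMeasure]

end Relabel

section BondEquiv

variable {P P' : Params} {j j' : ℕ}

/-- The canonical identification of the sites of two levels with the same dimension and the same number of sites per direction:
coordinatewise `ZMod.ringEquivCongr`, directions relabelled by `Fin.cast`. [folklore] -/
def siteEquiv (hd : P.d = P'.d) (hs : P.sitesPerDir j = P'.sitesPerDir j') : Site P j ≃ Site P' j' where
  toFun x := fun μ' => ZMod.ringEquivCongr hs (x (Fin.cast hd.symm μ'))
  invFun x' := fun μ => (ZMod.ringEquivCongr hs).symm (x' (Fin.cast hd μ))
  left_inv x := by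
    funext μ
    have hμ : Fin.cast hd.symm (Fin.cast hd μ) = μ := Fin.ext rfl
    simp only [hμ, RingEquiv.symm_apply_apply]
  right_inv x' := by
    funext μ'
    have hμ : Fin.cast hd (Fin.cast hd.symm μ') = μ' := Fin.ext rfl
    simp only [hμ, RingEquiv.apply_symm_apply]

/-- Pointwise formula. [folklore] -/
@[simp] theorem siteEquiv_apply (hd : P.d = P'.d) (hs : P.sitesPerDir j = P'.sitesPerDir j') (x : Site P j) (μ' : Fin P'.d) :
    siteEquiv hd hs x μ' = ZMod.ringEquivCongr hs (x (Fin.cast hd.symm μ')) := rfl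

/-- **`siteEquiv` is a torus isomorphism**: it commutes with the lattice shifts `x ↦ x + e_μ`. [folklore] -/
theorem siteEquiv_shift (hd : P.d = P'.d) (hs : P.sitesPerDir j = P'.sitesPerDir j') (x : Site P j) (μ : Fin P.d) :
    siteEquiv hd hs (x.shift μ) = (siteEquiv hd hs x).shift (Fin.cast hd μ) := by
  funext μ'
  simp only [siteEquiv_apply, Site.shift, Function.update_apply]
  have hc : (Fin.cast hd.symm μ' = μ) ↔ (μ' = Fin.cast hd μ) := by
    constructor
    · intro h; ext; simpa using congrArg Fin.val h
    · intro h; ext; simpa using congrArg Fin.val h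
  have hμ : Fin.cast hd.symm (Fin.cast hd μ) = μ := Fin.ext rfl
  by_cases h : μ' = Fin.cast hd μ
  · rw [if_pos (hc.2 h), if_pos h, hμ, map_add, map_one]
  · rw [if_neg (fun h' => h (hc.1 h')), if_neg h]

/-- The induced identification of (positively oriented) bonds. [folklore] -/
def bondEquiv (hd : P.d = P'.d) (hs : P.sitesPerDir j = P'.sitesPerDir j') : PBond P j ≃ PBond P' j' where
  toFun b := ⟨siteEquiv hd hs b.src, Fin.cast hd b.dir⟩
  invFun b' := ⟨(siteEquiv hd hs).symm b'.src, Fin.cast hd.symm b'.dir⟩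
  left_inv b := by
    obtain ⟨src, dir⟩ := b
    have h1 : Fin.cast hd.symm (Fin.cast hd dir) = dir := Fin.ext rfl
    simp only [Equiv.symm_apply_apply, h1]
  right_inv b' := by
    obtain ⟨src, dir⟩ := b'
    have h1 : Fin.cast hd (Fin.cast hd.symm dir) = dir := Fin.ext rfl
    simp only [Equiv.apply_symm_apply, h1]

/-- Components of `bondEquiv`. [folklore] -/
@[simp] theorem bondEquiv_src (hd : P.d = P'.d) (hs : P.sitesPerDir j = P'.sitesPerDir j') (b : PBond P j) :
    (bondEquiv hd hs b).src = siteEquiv hd hs b.src := rfl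

/-- Components of `bondEquiv`. [folklore] -/
@[simp] theorem bondEquiv_dir (hd : P.d = P'.d) (hs : P.sitesPerDir j = P'.sitesPerDir j') (b : PBond P j) :
    (bondEquiv hd hs b).dir = Fin.cast hd b.dir := rfl

/-- **Bonds go to bonds with the right endpoints**: `bondEquiv` commutes with `PBond.tgt`. [folklore] -/
theorem bondEquiv_tgt (hd : P.d = P'.d) (hs : P.sitesPerDir j = P'.sitesPerDir j') (b : PBond P j) :
    (bondEquiv hd hs b).tgt = siteEquiv hd hs b.tgt := by
  show (siteEquiv hd hs b.src).shift (Fin.cast hd b.dir) = siteEquiv hd hs (b.src.shift b.dir)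
  rw [siteEquiv_shift]

/-- **The window record** of design (W): same `d`, `L`, `m`, cutoff parameter replaced by the window depth `N_W` — it does not
mention `P.K`. [folklore] -/
def window (P : Params) (NW : ℕ) : Params := ⟨P.d, P.L, P.m, NW, P.hd, P.hL⟩

/-- Field-by-field description of the window record. [folklore] -/
theorem window_d (P : Params) (NW : ℕ) : (window P NW).d = P.d := rfl

/-- Field-by-field description of the window record. [folklore] -/
theorem window_L (P : Params) (NW : ℕ) : (window P NW).L = P.L := rfl

/-- Field-by-field description of the window record. [folklore] -/
theorem window_m (P : Params) (NW : ℕ) : (window P NW).m = P.m := rfl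

/-- Field-by-field description of the window record. [folklore] -/
theorem window_K (P : Params) (NW : ℕ) : (window P NW).K = NW := rfl

/-- Two cutoff records with the same `d`, `L`, `m` have THE SAME window record: the window is `K`-independent. [folklore] -/
theorem window_eq_of_eq {P P' : Params} (hd : P.d = P'.d) (hL : P.L = P'.L) (hm : P.m = P'.m) (NW : ℕ) :
    window P NW = window P' NW := by
  obtain ⟨d, L, m, K, hd0, hL0⟩ := P
  obtain ⟨d', L', m', K', hd1, hL1⟩ := P'
  simp only at hd hL hm
  subst hd hL hm
  rfl

/-- Sites per direction of the window record. [folklore] -/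
theorem sitesPerDir_window_eq (P : Params) (NW j' : ℕ) : (window P NW).sitesPerDir j' = 2 * P.L ^ (P.m + NW - j') := rfl

/-- **Numerology of design (W)**: for `N_W ≤ K`, level `K − N_W + j'` of `P` and level `j'` of the window record have the same
number of sites per direction, `2·L^{m+N_W−j'}`. [folklore] -/
theorem sitesPerDir_window (P : Params) {NW : ℕ} (hNW : NW ≤ P.K) (j' : ℕ) :
    P.sitesPerDir (P.K - NW + j') = (window P NW).sitesPerDir j' := by
  rw [sitesPerDir_window_eq, Params.sitesPerDir]
  have : P.m + P.K - (P.K - NW + j') = P.m + NW - j' := by omega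
  rw [this]

/-- **The window relabelling**: bonds of the window record at level `j'` ≃ bonds of `P` at level `K − N_W + j'`. [folklore] -/
def windowBondEquiv (P : Params) {NW : ℕ} (hNW : NW ≤ P.K) (j' : ℕ) :
    PBond (window P NW) j' ≃ PBond P (P.K - NW + j') :=
  (bondEquiv (P := P) (P' := window P NW) rfl (sitesPerDir_window P hNW j')).symm

end BondEquiv

section WindowRelabel

open T4LipschitzLedger T4FiniteEpsInhabited

variable {ι : Type*} {G : Type*} [GaugeGroup G] [MeasurableSpace G] [HaarData G]
  {l₀ : ℝ} {T : ℕ → Finset ι} {X : ℕ → ℝ → ι → ℝ} {χ : ℕ → ℝ → ℝ} {κ Lχ : ℕ → ℝ} {N₀ : ℕ} {n : ℕ → ℕ}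
  {m : ℕ → ι → ℕ} {slot : ℕ → ι → ℕ → Σ _ : ℕ, ℕ} {pol : ℕ → ι → ℕ → Pol} {θ : ℕ → ι → ℕ → ℝ}
  {PW : ℕ → ι → Params} {jW : ℕ → ι → ℕ}
  {uX uY : (K : ℕ) → (τ : ι) → ℕ → GaugeField (PW K τ) (jW K τ) G → ℝ}

/-- **THE WINDOW PRESENTATION WITH THE RELABELLING DISCHARGED**: `termRepr_window` with window reference := product Haar measure
on the window record's fields and `e K τ := relabel (ε K τ)` for any family of bond equivalences `ε K τ` (e.g. `windowBondEquiv`);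
no `he`, no `heμ` left. [folklore] -/
theorem termRepr_window_relabel (Pf : ℕ → ι → Params) (lvl k : ℕ → ι → ℕ)
    (avg : (K : ℕ) → (τ : ι) → (j : ℕ) → GaugeField (Pf K τ) j G → GaugeField (Pf K τ) (j+1) G)
    (havg : ∀ K τ j, Measurable (avg K τ j)) (hac : ∀ K τ, ∀ i < k K τ, HaarAC (avg K τ (lvl K τ + i)))
    (ε : (K : ℕ) → (τ : ι) → PBond (PW K τ) (jW K τ) ≃ PBond (Pf K τ) (lvl K τ + k K τ))
    (hmeas : ∀ K, ∀ τ ∈ T K, ∀ i < m K τ, Measurable (uX K τ i) ∧ Measurable (uY K τ i))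
    {F : (K : ℕ) → ℝ → (τ : ι) → GaugeField (Pf K τ) (lvl K τ) G → ℝ}
    (h : TermRepr l₀ T X χ κ Lχ N₀ n (fun K τ => fieldMeasure (Pf K τ) (lvl K τ) G) m slot pol θ
      (fun K τ i w => uX K τ i (relabel (ε K τ) (towerMap (avg K τ) (lvl K τ) (k K τ) w)))
      (fun K τ i w => uY K τ i (relabel (ε K τ) (towerMap (avg K τ) (lvl K τ) (k K τ) w))) F) :
    TermRepr l₀ T X χ κ Lχ N₀ n (fun K τ => fieldMeasure (PW K τ) (jW K τ) G) m slot pol θ uX uY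
      (fun K t τ a => (perfDensity (fieldMeasure (Pf K τ) (lvl K τ) G) (F K t τ)
        (relabel (ε K τ) ∘ towerMap (avg K τ) (lvl K τ) (k K τ)) (fieldMeasure (PW K τ) (jW K τ) G) a : ℝ)) :=
  termRepr_window Pf lvl k avg havg hac (fun K τ => fieldMeasure (PW K τ) (jW K τ) G) (fun K τ => relabel (ε K τ))
    (fun K τ => measurable_relabel (ε K τ)) (fun K τ => relabel_haarAC (ε K τ)) hmeas h

end WindowRelabel

section WindowRelabelSUN

open T4LipschitzLedger T4FiniteEpsInhabited BlockAveraging ExpMeanLog BlockAveragingEMLFibreLawSUN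

variable {ι : Type*} {N : ℕ} [NeZero N]
  {l₀ : ℝ} {T : ℕ → Finset ι} {X : ℕ → ℝ → ι → ℝ} {χ : ℕ → ℝ → ℝ} {κ Lχ : ℕ → ℝ} {N₀ : ℕ} {n : ℕ → ℕ}
  {m : ℕ → ι → ℕ} {slot : ℕ → ι → ℕ → Σ _ : ℕ, ℕ} {pol : ℕ → ι → ℕ → Pol} {θ : ℕ → ι → ℕ → ℝ}
  {PW : ℕ → ι → Params} {jW : ℕ → ι → ℕ}
  {uX uY : (K : ℕ) → (τ : ι) → ℕ → GaugeField (PW K τ) (jW K τ) (SU N) → ℝ}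

/-- **Design (W) on `SU(N)` with exp-mean-log block averaging, relabelling discharged**: the only inputs left are the standing
range `lvl + k ≤ m + K`, the measurability of the window variables ON the window, and the finest-level `TermRepr` (owed item (o1)).
[folklore] -/
theorem termRepr_window_SUN_relabel (Pf : ℕ → ι → Params) (lvl k : ℕ → ι → ℕ)
    (hr : ∀ K τ, lvl K τ + k K τ ≤ (Pf K τ).m + (Pf K τ).K)
    (ε : (K : ℕ) → (τ : ι) → PBond (PW K τ) (jW K τ) ≃ PBond (Pf K τ) (lvl K τ + k K τ))
    (hmeas : ∀ K, ∀ τ ∈ T K, ∀ i < m K τ, Measurable (uX K τ i) ∧ Measurable (uY K τ i))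
    {F : (K : ℕ) → ℝ → (τ : ι) → GaugeField (Pf K τ) (lvl K τ) (SU N) → ℝ}
    (h : TermRepr l₀ T X χ κ Lχ N₀ n (fun K τ => fieldMeasure (Pf K τ) (lvl K τ) (SU N)) m slot pol θ
      (fun K τ i w => uX K τ i (relabel (ε K τ) (towerMap (fun j => (avgFun (expMeanLogSU : LoopAverage (SU N)) :
        GaugeField (Pf K τ) j (SU N) → GaugeField (Pf K τ) (j+1) (SU N))) (lvl K τ) (k K τ) w)))
      (fun K τ i w => uY K τ i (relabel (ε K τ) (towerMap (fun j => (avgFun (expMeanLogSU : LoopAverage (SU N)) :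
        GaugeField (Pf K τ) j (SU N) → GaugeField (Pf K τ) (j+1) (SU N))) (lvl K τ) (k K τ) w))) F) :
    TermRepr l₀ T X χ κ Lχ N₀ n (fun K τ => fieldMeasure (PW K τ) (jW K τ) (SU N)) m slot pol θ uX uY
      (fun K t τ a => (perfDensity (fieldMeasure (Pf K τ) (lvl K τ) (SU N)) (F K t τ)
        (relabel (ε K τ) ∘ towerMap (fun j => (avgFun (expMeanLogSU : LoopAverage (SU N)) :
          GaugeField (Pf K τ) j (SU N) → GaugeField (Pf K τ) (j+1) (SU N))) (lvl K τ) (k K τ))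
        (fieldMeasure (PW K τ) (jW K τ) (SU N)) a : ℝ)) :=
  termRepr_window_SUN Pf lvl k hr (fun K τ => fieldMeasure (PW K τ) (jW K τ) (SU N)) (fun K τ => relabel (ε K τ))
    (fun K τ => measurable_relabel (ε K τ)) (fun K τ => relabel_haarAC (ε K τ)) hmeas h

end WindowRelabelSUN

/-! ## §7e SANITY: the relabelling lemmas fire on a concrete record -/

namespace Sanity

/-- A concrete cutoff record: `d = 4`, `L = 3`, `m = 1`, cutoff parameter `K = 5`. [folklore] -/
def P5 : Params := ⟨4, 3, 1, 5, by norm_num, ⟨⟨1, rfl⟩, by norm_num⟩⟩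

/-- The same physical data at cutoff `K = 9`. [folklore] -/
def P9 : Params := ⟨4, 3, 1, 9, by norm_num, ⟨⟨1, rfl⟩, by norm_num⟩⟩

/-- The window record of depth `N_W = 2` is the same for both cutoffs (`K`-independence). [folklore] -/
theorem window_P5_eq_window_P9 : window P5 2 = window P9 2 := window_eq_of_eq rfl rfl rfl 2

/-- The window relabelling exists at both cutoffs: level `3 = 5 − 2` of `P5` and level `7 = 9 − 2` of `P9` are relabelled onto
level `0` of the common window record, and product Haar measure on `SU(N)` fields goes to product Haar measure. [folklore] -/
theorem map_relabel_window_P9 {N : ℕ} [NeZero N] :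
    (fieldMeasure P9 (P9.K - 2 + 0) (SU N)).map (relabel (windowBondEquiv P9 (show 2 ≤ P9.K by decide) 0)) =
      fieldMeasure (window P9 2) 0 (SU N) :=
  map_relabel_fieldMeasure _

end Sanity

end

end Literature.MathematicalPhysics.QuantumFieldTheory.Balaban1983to89.T4AveragingDisintegration
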